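import Literature.NumberTheory.CubicFields.VoronoiRelativeMinima
import Literature.NumberTheory.CubicFields.VoronoiChain
import Literature.NumberTheory.CubicFields.VoronoiChainRescale
import Literature.NumberTheory.CubicFields.VoronoiChainFilter
import Literature.NumberTheory.CubicFields.VoronoiCylinderStep
import Literature.NumberTheory.CubicFields.PeriodicChainCells
import Literature.NumberTheory.CubicFields.PureCubicIdealCodes
import Literature.NumberTheory.CubicFields.RelationLatticeLift
import Mathlib.NumberTheory.NumberField.ClassNumber
import Literature.NumberTheory.CubicFields.PeriodicChainCellsGrid
import Mathlib.Analysis.SpecialFunctions.Log.Basic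
import Mathlib.Analysis.Complex.ExponentialBounds
import Literature.Computability.Cryptography.CubicClassTableCoins
import Literature.Computability.Cryptography.CubicClassTableSpecs
import Literature.NumberTheory.CubicFields.PureCubicLatticeSemantics
import Literature.NumberTheory.NumberFields.PureCubicOrder
import Literature.Computability.Cryptography.CubicClassTableProgramSpecs
import Literature.NumberTheory.NumberFields.PureCubicEmbeddings
import Literature.NumberTheory.CubicFields.PeriodicChainCellsDefects
import Literature.Computability.Cryptography.CubicClassSamplingSpecs
import Literature.Computability.Cryptography.CubicClassTableSemPackages
import HarnessLib

/-!
# The pure-cubic class-group table semantics, II: Voronoi cycle, classes/cells/coins/slots packages — `ClaimTableSem` HOLDS (re-homed proofs)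

**The semantics claim `ClaimTableSem` of the pure-cubic class-group table HOLDS — file 2 of 2 (packages and the assembly `ClaimTableSem_holds`)** — the named fact
`Literature.Computability.Cryptography.CubicClassSampling.ClaimTableSem` (`CubicClassSamplingSpecs.lean`; the class-group table of a
pure cubic field read as a shift-cell / coset table over the Voronoi chain of the reduced-ideal cycle: Buchmann–Williams, Math. Comp. 50
(1988), §3 [BuchmannWilliams1988]; Hallgren, STOC 2005, §4 [Hallgren2005]), EXACT name
`Literature.Computability.Cryptography.CubicClassSampling.ClaimTableSem_holds`.  The proof is the assembly of the tree's Literature layer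
`Literature/Computability/Cryptography/CubicClassTableSem{Step,Pow,BE,Ladder,Descend,Walk}.lean`, `CubicClassTable{Specs,Coins,ProgramSpecs}.lean`
and `Literature/NumberTheory/CubicFields/*` (Voronoi reduction / relative minima / chains, periodic chain cells, pure cubic lattice
semantics, relation lattices, regulator bounds) with the 81 remaining theorems of the Summits side: the regulator/period bookkeeping, the
class-table numerics, the walk package, the per-position semantics (cells, coordinates, drift, core, circle, affine charts), packing,
the filtered Voronoi cycle, the relation-lattice index, classes/cells/coins/index/slots packages, the reduced giant-step cycle, and the
final assembly `ClaimTableSem_holds`.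
RE-HOMED into `Literature/` by the Hodge foundations lane (`lit-hodgefound`, seat p20, generation 40): verbatim DECLARATION-LEVEL ports (the
declarations needed, in dependency order) of 24 theorem-only modules `Summits/QuantumAdvantage/QuantumAdvantage/Theorems/LinnikCubicClassGroupsPureCubicClassGroupFBQP{Stub*,∅}.lean`,
namespace `Summit.QuantumAdvantage.QuantumAdvantage.Theorems.LinnikCubicClassGroups` re-rooted as
`Literature.Computability.Cryptography.CubicClassSampling.LinnikStubs` (the convention of `CubicClassSamplingClaimsHold.lean`; the in-tree theorem
names are kept so that twins have the same short names).  Theorem-only file: no definition, no new named fact (D-0026); imports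
Mathlib/Literature only; every declaration carries the citation of the printed statement it formalises or serves.  The Summits originals
stay in place (transitional duplication).  WHAT THIS IS NOT: nothing here bears on `BQP ⊄ BPP` or any quantum-advantage statement; it is
the classical number-theoretic semantics of the class-group table of a pure cubic field.
-/

noncomputable section

/-!
## Part 1 — port of `Summits/QuantumAdvantage/QuantumAdvantage/Theorems/LinnikCubicClassGroupsPureCubicClassGroupFBQPStubVoronoiChain.lean` (8 declarations kept)

# `LinnikCubicClassGroups.PureCubicClassGroupFBQP` ()

Declarations of this Part (verbatim port; each keeps its own docstring and citation): `voronoiSucc_injOn`, `voronoiChain_periodic`, `voronoiChain_shift_pos`, `voronoiChain_six_gap`, `voronoi_absNorm_le_abs_norm`, `voronoi_places`, `voronoi_exists_short`, `voronoiChain_gap_le`.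
-/

section Part1

namespace Literature.Computability.Cryptography.CubicClassSampling.LinnikStubs

open scoped _root_.NumberField ComplexConjugate
open _root_.NumberField
open Literature.NumberTheory.CubicFields

section Period

variable {K : Type} [Field K] [NumberField K] {σ₁ : K →+* ℝ} {σ₂ : K →+* ℂ}
  {I : FractionalIdeal (nonZeroDivisors (𝓞 K)) K}
variable (hdeg : Module.finrank ℚ K = 3) (hσ₂ : ∃ z : K, starRingEnd ℂ (σ₂ z) ≠ σ₂ z)
  (ε : (𝓞 K)ˣ) (hε : 1 < σ₁ (algebraMap (𝓞 K) K ε))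

include hdeg hσ₂ hε in
/-- `voronoiSucc` is injective on the positive minima.
[cite: BuchmannWilliams1988, §3 (semantics of the class-group table; supporting lemma)] -/
theorem voronoiSucc_injOn {μ μ' : K} (hμ : μ ∈ posRelMinima σ₁ σ₂ I) (hμ' : μ' ∈ posRelMinima σ₁ σ₂ I)
    (h : voronoiSucc σ₁ σ₂ I μ = voronoiSucc σ₁ σ₂ I μ') : μ = μ' := by
  rw [← voronoiPred_succ hdeg hσ₂ ε hε hμ, ← voronoiPred_succ hdeg hσ₂ ε hε hμ', h]

include hdeg hσ₂ hε in
/-- **Periodicity of the chain under a positive unit**: multiplication by `u` shifts the chain by a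
constant. [cite: BuchmannWilliams1988, §3 (semantics of the class-group table; supporting lemma)] -/
theorem voronoiChain_periodic {x₀ : K} (hx₀ : x₀ ∈ posRelMinima σ₁ σ₂ I) (u : (𝓞 K)ˣ) (hu : 0 < σ₁ (algebraMap (𝓞 K) K u)) :
    ∃ c : ℤ, ∀ i : ℤ, voronoiChain σ₁ σ₂ I x₀ (i + c) = algebraMap (𝓞 K) K u * voronoiChain σ₁ σ₂ I x₀ i := by
  obtain ⟨c, hc⟩ := exists_voronoiChain_eq hdeg hσ₂ ε hε hx₀ (unit_mul_mem_posRelMinima hx₀ u hu)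
  refine ⟨c, fun i => ?_⟩
  induction i with
  | zero => rw [zero_add, hc, voronoiChain_zero]
  | succ i ih =>
    rw [voronoiChain_succ hdeg hσ₂ ε hε hx₀, ← voronoiSucc_unit_mul hdeg hσ₂ ε hε (voronoiChain_mem hdeg hσ₂ ε hε hx₀ i) u hu, ← ih,
      show (i : ℤ) + 1 + c = (i + c) + 1 by ring, voronoiChain_succ hdeg hσ₂ ε hε hx₀]
  | pred i ih =>
    apply voronoiSucc_injOn hdeg hσ₂ ε hε (voronoiChain_mem hdeg hσ₂ ε hε hx₀ _)
      (unit_mul_mem_posRelMinima (voronoiChain_mem hdeg hσ₂ ε hε hx₀ _) u hu)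
    rw [← voronoiChain_succ hdeg hσ₂ ε hε hx₀, voronoiSucc_unit_mul hdeg hσ₂ ε hε (voronoiChain_mem hdeg hσ₂ ε hε hx₀ _) u hu, ← voronoiChain_succ hdeg hσ₂ ε hε hx₀,
      show -(i : ℤ) - 1 + c + 1 = -i + c by ring, show -(i : ℤ) - 1 + 1 = -i by ring, ih]

include hdeg hσ₂ hε in
/-- The shift of a unit with `σ₁ > 1` is positive.
[cite: BuchmannWilliams1988, §3 (semantics of the class-group table; supporting lemma)] -/
theorem voronoiChain_shift_pos {x₀ : K} (hx₀ : x₀ ∈ posRelMinima σ₁ σ₂ I) (u : (𝓞 K)ˣ) (hu : 1 < σ₁ (algebraMap (𝓞 K) K u)) {c : ℤ}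
    (hc : ∀ i : ℤ, voronoiChain σ₁ σ₂ I x₀ (i + c) = algebraMap (𝓞 K) K u * voronoiChain σ₁ σ₂ I x₀ i) :
    0 < c := by
  have h0 := hc 0
  rw [zero_add] at h0
  have hlt : σ₁ (voronoiChain σ₁ σ₂ I x₀ 0) < σ₁ (voronoiChain σ₁ σ₂ I x₀ c) := by
    rw [h0, map_mul]
    have hp : 0 < σ₁ (voronoiChain σ₁ σ₂ I x₀ 0) := (voronoiChain_mem hdeg hσ₂ ε hε hx₀ 0).2
    nlinarith
  exact (voronoiChain_strictMono hdeg hσ₂ ε hε hx₀).lt_iff_lt.mp hlt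

include hdeg hσ₂ hε in
/-- **The six-gap** (from the packing of S1 `stub_packing`): six steps along the chain at least
double the real conjugate. [cite: BuchmannWilliams1988, §3 (semantics of the class-group table; supporting lemma)] -/
theorem voronoiChain_six_gap
    (h1 : ∀ (K : Type) [Field K] (σ₁ : K →+* ℝ) (σ₂ : K →+* ℂ) (L : AddSubgroup K) (t : ℝ),
      0 < t → Set.encard {θ : K | θ ∈ L ∧ θ ≠ 0 ∧
        (∀ φ ∈ L, φ ≠ 0 → |σ₁ φ| < |σ₁ θ| → ‖σ₂ θ‖ ≤ ‖σ₂ φ‖) ∧ t ≤ σ₁ θ ∧ σ₁ θ < 2 * t} ≤ 6)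
    {x₀ : K} (hx₀ : x₀ ∈ posRelMinima σ₁ σ₂ I) (i : ℤ) :
    2 * σ₁ (voronoiChain σ₁ σ₂ I x₀ i) ≤ σ₁ (voronoiChain σ₁ σ₂ I x₀ (i + 6)) := by
  by_contra hcon
  push Not at hcon
  set t : ℝ := σ₁ (voronoiChain σ₁ σ₂ I x₀ i) with ht
  have ht0 : 0 < t := (voronoiChain_mem hdeg hσ₂ ε hε hx₀ i).2
  set L : AddSubgroup K := (I : Submodule (𝓞 K) K).toAddSubgroup with hL
  have hmemL : ∀ x : K, x ∈ L ↔ x ∈ I := fun x => by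
    rw [hL, Submodule.mem_toAddSubgroup, FractionalIdeal.mem_coe]
  have h6 := h1 K σ₁ σ₂ L t ht0
  set S : Set K := {θ : K | θ ∈ L ∧ θ ≠ 0 ∧
    (∀ φ ∈ L, φ ≠ 0 → |σ₁ φ| < |σ₁ θ| → ‖σ₂ θ‖ ≤ ‖σ₂ φ‖) ∧ t ≤ σ₁ θ ∧ σ₁ θ < 2 * t} with hS
  have hmono := (voronoiChain_strictMono hdeg hσ₂ ε hε hx₀).monotone
  have hmaps : Set.MapsTo (fun j : Fin 7 => voronoiChain σ₁ σ₂ I x₀ (i + (j : ℕ)))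
      ((Finset.univ : Finset (Fin 7)) : Set (Fin 7)) S := by
    intro j _
    have hm := voronoiChain_mem hdeg hσ₂ ε hε hx₀ (i + (j : ℕ))
    refine ⟨(hmemL _).mpr hm.1.1, hm.1.2.1, fun φ hφ h0 hlt => hm.1.2.2 φ ((hmemL φ).mp hφ) h0 hlt, ?_, ?_⟩
    · exact hmono (show i ≤ i + (j : ℕ) by omega)
    · have hj : (j : ℕ) ≤ 6 := Nat.lt_succ_iff.mp j.isLt
      exact lt_of_le_of_lt (hmono (show i + (j : ℕ) ≤ i + 6 by omega)) hcon
  have hinj : Set.InjOn (fun j : Fin 7 => voronoiChain σ₁ σ₂ I x₀ (i + (j : ℕ)))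
      ((Finset.univ : Finset (Fin 7)) : Set (Fin 7)) := by
    intro a _ b _ hab
    have h := congrArg σ₁ hab
    have := (voronoiChain_strictMono hdeg hσ₂ ε hε hx₀).injective h
    exact Fin.ext (by omega)
  have h7 := Set.encard_le_encard_of_injOn hmaps hinj
  rw [Set.encard_coe_eq_coe_finsetCard, Finset.card_univ, Fintype.card_fin] at h7
  have h76 := h7.trans h6
  norm_num at h76

end Period

section Minkowski

variable {K : Type} [Field K] [NumberField K] {σ₁ : K →+* ℝ} {σ₂ : K →+* ℂ}
  {I : FractionalIdeal (nonZeroDivisors (𝓞 K)) K}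

/-- **Containment bounds the norm**: a nonzero element of a nonzero fractional ideal has
`|N(t)| ≥ N(I)`. [cite: BuchmannWilliams1988, §3 (semantics of the class-group table; supporting lemma)] -/
theorem voronoi_absNorm_le_abs_norm (hI : I ≠ 0) {t : K} (ht : t ∈ I) (ht0 : t ≠ 0) :
    ((FractionalIdeal.absNorm I : ℚ) : ℝ) ≤ |((Algebra.norm ℚ t : ℚ) : ℝ)| := by
  classical
  set J : FractionalIdeal (nonZeroDivisors (𝓞 K)) K := FractionalIdeal.spanSingleton _ t with hJ
  have hJle : J ≤ I := FractionalIdeal.spanSingleton_le_iff_mem.mpr ht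
  have hJ0 : J ≠ 0 := by rw [hJ, Ne, FractionalIdeal.spanSingleton_eq_zero_iff]; exact ht0
  have hdecomp : J = I * (I⁻¹ * J) := by rw [← mul_assoc, mul_inv_cancel₀ hI, one_mul]
  have hle1 : I⁻¹ * J ≤ 1 := by
    calc I⁻¹ * J ≤ I⁻¹ * I := by gcongr
      _ = 1 := inv_mul_cancel₀ hI
  obtain ⟨B, hB⟩ := FractionalIdeal.le_one_iff_exists_coeIdeal.mp hle1
  have hB0 : B ≠ ⊥ := by
    intro h
    rw [h, FractionalIdeal.coeIdeal_bot] at hB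
    have : I⁻¹ * J = 0 := hB.symm
    rcases mul_eq_zero.mp this with h' | h'
    · exact (inv_ne_zero hI) h'
    · exact hJ0 h'
  have hNB : (1 : ℚ) ≤ FractionalIdeal.absNorm (I⁻¹ * J) := by
    rw [← hB, FractionalIdeal.coeIdeal_absNorm]
    have : 1 ≤ Ideal.absNorm B := Nat.one_le_iff_ne_zero.mpr (by rwa [Ne, Ideal.absNorm_eq_zero_iff])
    exact_mod_cast this
  have hNJ : FractionalIdeal.absNorm J = |Algebra.norm ℚ t| := by
    rw [hJ]; exact FractionalIdeal.absNorm_span_singleton (𝓞 K) t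
  have key : FractionalIdeal.absNorm I ≤ FractionalIdeal.absNorm J := by
    conv_rhs => rw [hdecomp]
    rw [map_mul]
    have h0 : 0 ≤ FractionalIdeal.absNorm I := FractionalIdeal.absNorm_nonneg I
    nlinarith
  rw [hNJ] at key
  have : ((FractionalIdeal.absNorm I : ℚ) : ℝ) ≤ ((|Algebra.norm ℚ t| : ℚ) : ℝ) := by exact_mod_cast key
  simpa [Rat.cast_abs] using this

variable (hdeg : Module.finrank ℚ K = 3) (hσ₂ : ∃ z : K, starRingEnd ℂ (σ₂ z) ≠ σ₂ z)
  (ε : (𝓞 K)ˣ) (hε : 1 < σ₁ (algebraMap (𝓞 K) K ε))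

include hdeg hσ₂ in
/-- Signature (1,1): the two infinite voronoi_places, their multiplicities and the Minkowski factors.
[cite: BuchmannWilliams1988, §3 (semantics of the class-group table; supporting lemma)] -/
theorem voronoi_places (σ₁ : K →+* ℝ) :
    ∃ w₁ w₂ : InfinitePlace K, w₁.IsReal ∧ w₂.IsComplex ∧ w₁ ≠ w₂ ∧
      (∀ w : InfinitePlace K, w = w₁ ∨ w = w₂) ∧ (∀ x, w₁ x = |σ₁ x|) ∧ (∀ x, w₂ x = ‖σ₂ x‖) ∧
      NumberField.InfinitePlace.nrRealPlaces K = 1 ∧ NumberField.InfinitePlace.nrComplexPlaces K = 1 := by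
  classical
  set w₁ : InfinitePlace K := InfinitePlace.mk ((algebraMap ℝ ℂ).comp σ₁) with hw₁
  set w₂ : InfinitePlace K := InfinitePlace.mk σ₂ with hw₂
  have h1 : w₁.IsReal := by
    rw [hw₁, InfinitePlace.isReal_mk_iff, ComplexEmbedding.isReal_iff]
    exact conjugate_ofReal_comp σ₁
  have h2 : w₂.IsComplex := by
    rw [hw₂, InfinitePlace.isComplex_mk_iff, ComplexEmbedding.isReal_iff]
    exact conjugate_ne_self σ₂ hσ₂
  have hne : w₁ ≠ w₂ := fun h => by
    rw [h] at h1; exact (InfinitePlace.not_isReal_iff_isComplex.mpr h2) h1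
  have hsig : NumberField.InfinitePlace.nrRealPlaces K = 1 ∧ NumberField.InfinitePlace.nrComplexPlaces K = 1 := by
    have h := NumberField.InfinitePlace.card_add_two_mul_card_eq_rank K
    rw [hdeg] at h
    have hc : 0 < NumberField.InfinitePlace.nrComplexPlaces K := Fintype.card_pos_iff.mpr ⟨⟨w₂, h2⟩⟩
    have hr : 0 < NumberField.InfinitePlace.nrRealPlaces K := Fintype.card_pos_iff.mpr ⟨⟨w₁, h1⟩⟩
    omega
  have hcard : Fintype.card (InfinitePlace K) = 2 := by
    rw [NumberField.InfinitePlace.card_eq_nrRealPlaces_add_nrComplexPlaces, hsig.1, hsig.2]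
  have huniv : (Finset.univ : Finset (InfinitePlace K)) = {w₁, w₂} := by
    symm; apply Finset.eq_univ_of_card
    rw [hcard, Finset.card_pair hne]
  have hall : ∀ w : InfinitePlace K, w = w₁ ∨ w = w₂ := fun w => by
    have hw := Finset.mem_univ w
    rw [huniv] at hw
    simpa using hw
  refine ⟨w₁, w₂, h1, h2, hne, hall, fun x => ?_, fun x => ?_, hsig.1, hsig.2⟩
  · rw [hw₁, InfinitePlace.apply]
    simp [Complex.norm_real]
  · rw [hw₂, InfinitePlace.apply]

include hdeg hσ₂ in
/-- **Minkowski in the normed body**: for `t ∈ I` nonzero there is a nonzero `a ∈ I` with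
`|σ₁ a| < (2√|d_K|/π + 1) σ₁ t` hm and `‖σ₂ a‖ < ‖σ₂ t‖` — provided `σ₁ t > 0`.
[cite: BuchmannWilliams1988, §3 (semantics of the class-group table; supporting lemma)] -/
theorem voronoi_exists_short (hI : I ≠ 0) {t : K} (ht : t ∈ I) (ht0 : t ≠ 0) (htpos : 0 < σ₁ t) :
    ∃ a ∈ I, a ≠ 0 ∧ |σ₁ a| < (2 * Real.sqrt |(NumberField.discr K : ℝ)| / Real.pi + 1) * σ₁ t ∧
      ‖σ₂ a‖ < ‖σ₂ t‖ := by
  classical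
  obtain ⟨w₁, w₂, hw₁, hw₂, hne, hall, hw₁x, hw₂x, hr, hc⟩ := voronoi_places hdeg hσ₂ σ₁
  have huniv : (Finset.univ : Finset (InfinitePlace K)) = {w₁, w₂} := by
    ext w; simpa using hall w
  set X : ℝ := 2 * Real.sqrt |(NumberField.discr K : ℝ)| / Real.pi + 1 with hX
  have hX0 : 0 < X := by positivity
  have hσt : 0 < ‖σ₂ t‖ := norm_pos_iff.mpr ((map_ne_zero σ₂).mpr ht0)
  set f : InfinitePlace K → NNReal := fun w => if w = w₁ then (X * σ₁ t).toNNReal else ‖σ₂ t‖₊ with hf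
  set I₁ : (FractionalIdeal (nonZeroDivisors (𝓞 K)) K)ˣ := Units.mk0 I hI with hI₁
  -- the norm of `t` dominates the norm of `I`
  have hNt : ((FractionalIdeal.absNorm I : ℚ) : ℝ) ≤ σ₁ t * ‖σ₂ t‖ ^ 2 := by
    have h := voronoi_absNorm_le_abs_norm hI ht ht0
    rw [norm_eq_mul_norm_sq σ₁ σ₂ hdeg hσ₂ t, abs_of_pos (by positivity)] at h
    exact h
  have hNI : 0 < ((FractionalIdeal.absNorm I : ℚ) : ℝ) := by
    have h0 : FractionalIdeal.absNorm I ≠ 0 := fun h => hI (FractionalIdeal.absNorm_eq_zero_iff.mp h)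
    have := lt_of_le_of_ne (FractionalIdeal.absNorm_nonneg I) (Ne.symm h0)
    exact_mod_cast this
  -- Minkowski's hypothesis
  have hvol : NumberField.mixedEmbedding.minkowskiBound K I₁ <
      MeasureTheory.volume (NumberField.mixedEmbedding.convexBodyLT K f) := by
    rw [NumberField.mixedEmbedding.convexBodyLT_volume, huniv,
      Finset.prod_pair (f := fun w : InfinitePlace K => f w ^ w.mult) hne]
    have hm1 : w₁.mult = 1 := by rw [NumberField.InfinitePlace.mult, if_pos hw₁]
    have hm2 : w₂.mult = 2 := by
      rw [NumberField.InfinitePlace.mult, if_neg (InfinitePlace.not_isReal_iff_isComplex.mpr hw₂)]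
    have hf1 : f w₁ = (X * σ₁ t).toNNReal := by simp [hf]
    have hf2 : f w₂ = ‖σ₂ t‖₊ := by simp [hf, hne.symm]
    rw [hm1, hm2, hf1, hf2, pow_one]
    -- both sides are finite: compare the real values
    rw [← ENNReal.toReal_lt_toReal (NumberField.mixedEmbedding.minkowskiBound_lt_top K I₁).ne
      (ENNReal.mul_ne_top ENNReal.coe_ne_top ENNReal.coe_ne_top)]
    have hLHS : (NumberField.mixedEmbedding.minkowskiBound K I₁).toReal =
        FractionalIdeal.absNorm I * ((2 : ℝ)⁻¹ * Real.sqrt |(NumberField.discr K : ℝ)|) * 2 ^ 3 := by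
      simp_rw [NumberField.mixedEmbedding.minkowskiBound,
        NumberField.mixedEmbedding.volume_fundamentalDomain_fractionalIdealLatticeBasis,
        NumberField.mixedEmbedding.volume_fundamentalDomain_latticeBasis, ENNReal.toReal_mul, ENNReal.toReal_pow,
        ENNReal.toReal_inv, ENNReal.coe_toReal, ENNReal.toReal_ofNat, NumberField.mixedEmbedding.finrank]
      rw [ENNReal.toReal_ofReal (Rat.cast_nonneg.mpr (FractionalIdeal.absNorm_nonneg _)), hI₁, Units.val_mk0, hc,
        hdeg, Real.coe_sqrt, coe_nnnorm, Int.norm_eq_abs, pow_one]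
    have hRHS : ((NumberField.mixedEmbedding.convexBodyLTFactor K : ENNReal) *
        (((X * σ₁ t).toNNReal * ‖σ₂ t‖₊ ^ 2 : NNReal) : ENNReal)).toReal =
        2 * Real.pi * (X * σ₁ t * ‖σ₂ t‖ ^ 2) := by
      rw [ENNReal.toReal_mul, ENNReal.coe_toReal, ENNReal.coe_toReal]
      have hXt : ((X * σ₁ t).toNNReal : ℝ) = X * σ₁ t := Real.coe_toNNReal _ (by positivity)
      simp only [NumberField.mixedEmbedding.convexBodyLTFactor, NNReal.coe_mul, NNReal.coe_pow, hXt, coe_nnnorm,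
        NNReal.coe_real_pi, NNReal.coe_ofNat, hr, hc, pow_one]
    rw [hLHS, hRHS]
    -- `4 N(I) √Δ < (4√Δ + 2π) N(t)`, from `N(I) ≤ σ₁ t ‖σ₂ t‖² = N(t)`
    have hsq : 0 ≤ Real.sqrt |(NumberField.discr K : ℝ)| := Real.sqrt_nonneg _
    have hpi : 0 < Real.pi := Real.pi_pos
    have e : 2 * Real.pi * (X * σ₁ t * ‖σ₂ t‖ ^ 2) =
        (4 * Real.sqrt |(NumberField.discr K : ℝ)| + 2 * Real.pi) * (σ₁ t * ‖σ₂ t‖ ^ 2) := by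
      rw [hX]; field_simp; ring
    rw [e]
    nlinarith
  obtain ⟨a, ha, ha0, hlt⟩ := NumberField.mixedEmbedding.exists_ne_zero_mem_ideal_lt K I₁ hvol
  have haI : a ∈ I := by simpa [hI₁] using ha
  refine ⟨a, haI, ha0, ?_, ?_⟩
  · have h := hlt w₁
    rw [hw₁x] at h
    have hf1 : ((f w₁ : NNReal) : ℝ) = X * σ₁ t := by simp [hf, Real.coe_toNNReal _ (by positivity : 0 ≤ X * σ₁ t)]
    rw [hf1] at h; exact h
  · have h := hlt w₂
    rw [hw₂x] at h
    have hf2 : ((f w₂ : NNReal) : ℝ) = ‖σ₂ t‖ := by simp [hf, hne.symm]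
    rw [hf2] at h; exact h

include hdeg hσ₂ hε in
/-- **The gap bound**: one step of the chain multiplies the real conjugate by at most `3 √|d_K|`.
[cite: BuchmannWilliams1988, §3 (semantics of the class-group table; supporting lemma)] -/
theorem voronoiChain_gap_le (hI : I ≠ 0) {x₀ : K} (hx₀ : x₀ ∈ posRelMinima σ₁ σ₂ I) (i : ℤ) :
    σ₁ (voronoiChain σ₁ σ₂ I x₀ (i + 1)) ≤ 3 * Real.sqrt |(NumberField.discr K : ℝ)| * σ₁ (voronoiChain σ₁ σ₂ I x₀ i) := by
  have ht := voronoiChain_mem hdeg hσ₂ ε hε hx₀ i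
  obtain ⟨a, haI, ha0, h1, h2⟩ := voronoi_exists_short hdeg hσ₂ hI ht.1.1 ht.1.2.1 ht.2
  obtain ⟨μ, hμ, hμpos, hμ1, hμ2⟩ := exists_mem_relMinima_pos_le hdeg hσ₂ haI ha0
  have hμM : μ ∈ posRelMinima σ₁ σ₂ I := ⟨hμ, hμpos⟩
  have hμlt : ‖σ₂ μ‖ < ‖σ₂ (voronoiChain σ₁ σ₂ I x₀ i)‖ := lt_of_le_of_lt hμ2 h2
  have hne : voronoiChain σ₁ σ₂ I x₀ i ≠ μ := fun h => by rw [h] at hμlt; exact lt_irrefl _ hμlt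
  have hσlt : σ₁ (voronoiChain σ₁ σ₂ I x₀ i) < σ₁ μ :=
    (relMinima_lt_iff hdeg hσ₂ ht.1 hμ ht.2 hμpos hne).mpr hμlt
  have hnxt := (voronoiSucc_spec hdeg hσ₂ ε hε ht).2.2 μ hμM hσlt
  rw [voronoiChain_succ hdeg hσ₂ ε hε hx₀]
  have hsqrt : 1 ≤ Real.sqrt |(NumberField.discr K : ℝ)| := by
    rw [Real.one_le_sqrt]
    have h := NumberField.abs_discr_gt_two (K := K) (by rw [hdeg]; norm_num)
    have : (2 : ℝ) < |(NumberField.discr K : ℝ)| := by rw [← Int.cast_abs]; exact_mod_cast h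
    linarith
  have hX : 2 * Real.sqrt |(NumberField.discr K : ℝ)| / Real.pi + 1 ≤ 3 * Real.sqrt |(NumberField.discr K : ℝ)| := by
    have hpi := Real.pi_gt_three
    rw [div_add_one (ne_of_gt (by linarith)), div_le_iff₀ (by linarith)]
    nlinarith
  have hpos := ht.2
  calc σ₁ (voronoiSucc σ₁ σ₂ I (voronoiChain σ₁ σ₂ I x₀ i)) ≤ σ₁ μ := hnxt
    _ ≤ |σ₁ a| := hμ1
    _ ≤ (2 * Real.sqrt |(NumberField.discr K : ℝ)| / Real.pi + 1) * σ₁ (voronoiChain σ₁ σ₂ I x₀ i) := h1.le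
    _ ≤ 3 * Real.sqrt |(NumberField.discr K : ℝ)| * σ₁ (voronoiChain σ₁ σ₂ I x₀ i) :=
        mul_le_mul_of_nonneg_right hX hpos.le

end Minkowski

/-! ### The assembled chain theorem (= the stub `stub_voronoiChain`, S3a) -/

end Literature.Computability.Cryptography.CubicClassSampling.LinnikStubs

end Part1

/-!
## Part 2 — port of `Summits/QuantumAdvantage/QuantumAdvantage/Theorems/LinnikCubicClassGroupsPureCubicClassGroupFBQPStubCubicFilteredCycle.lean` (2 declarations kept)

# `LinnikCubicClassGroups.PureCubicClassGroupFBQP` () — stub `stub_cubicFilteredCycle`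

Declarations of this Part (verbatim port; each keeps its own docstring and citation): `unit_eq_zpow_of_pos`, `stub_cubicFilteredCycle`.
-/

section Part2

namespace Literature.Computability.Cryptography.CubicClassSampling.LinnikStubs

open scoped _root_.NumberField nonZeroDivisors
open _root_.NumberField
open Literature.NumberTheory.CubicFields

/-- **Units with positive real conjugate are powers of the regulator unit.** In a cubic field with a
real embedding `σ₁` and a non-real `σ₂`, if `ε` is a unit with `σ₁ ε > 1` and `log σ₁ ε = R_K`, then
every unit `u` with `σ₁ u > 0` is `ε ^ n` for some `n : ℤ` (as elements of `K`): by
`exists_one_lt_log_eq_regulator`, `|σ₁ u| = c ^ n` with `c > 1`, `log c = R_K`, so `c = σ₁ ε`.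
[cite: BuchmannWilliams1988, §3 (semantics of the class-group table; supporting lemma)] -/
theorem unit_eq_zpow_of_pos {K : Type} [Field K] [NumberField K] (hdeg : Module.finrank ℚ K = 3)
    (σ₁ : K →+* ℝ) (σ₂ : K →+* ℂ) (hσ₂ : ∃ z : K, starRingEnd ℂ (σ₂ z) ≠ σ₂ z) {ε : (𝓞 K)ˣ}
    (hε : 1 < σ₁ (algebraMap (𝓞 K) K ε))
    (hreg : Real.log (σ₁ (algebraMap (𝓞 K) K ε)) = NumberField.Units.regulator K)
    (u : (𝓞 K)ˣ) (hu : 0 < σ₁ (algebraMap (𝓞 K) K u)) :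
    ∃ n : ℤ, algebraMap (𝓞 K) K u = (algebraMap (𝓞 K) K ε) ^ n := by
  obtain ⟨c, hc1, hcreg, -, hpow⟩ := exists_one_lt_log_eq_regulator hdeg σ₁ σ₂ hσ₂
  have hcε : c = σ₁ (algebraMap (𝓞 K) K ε) :=
    Real.log_injOn_pos (Set.mem_Ioi.mpr (by linarith)) (Set.mem_Ioi.mpr (by linarith))
      (by rw [hcreg, hreg])
  obtain ⟨n, hn⟩ := hpow u
  refine ⟨n, σ₁.injective ?_⟩
  have hn' : |σ₁ (algebraMap (𝓞 K) K u)| = c ^ n := hn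
  rw [abs_of_pos hu] at hn'
  rw [map_zpow₀, ← hcε]
  exact hn'

/-- **S3b-T3a `stub_cubicFilteredCycle`** (number theory only, over the tree's `voronoiChain`/`posRelMinima` and
the landed `stub_voronoiChain`). For a cubic field with a real embedding `σ₁` and a non-real `σ₂`, a nonzero fractional
ideal `I` and a base minimum `x₀`, write `θ = voronoiChain σ₁ σ₂ I x₀`. Then: `θ` is purely periodic under the regulator
unit `ε` with period `n₀`, `n₀ log 2 ≤ 6 R`; the indices followed by a BIG GAP (`11 σ₁θ(j) ≤ 10 σ₁θ(j+1)`) are enumerated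
increasingly by `s : ℤ → ℤ` (normalised by `s 0 =` the least nonnegative one), consecutive ones at most `6` apart (six-gap:
among six consecutive gaps one has ratio `≥ 2^{1/6} > 11/10`), `s (i + nS) = s i + n₀`; filtered gaps lie in
`[log(11/10), 6 log(3√|d_K|)]`; the reduced ideals `J i = θ(s i)⁻¹ I` contain `1` as a minimum, repeat exactly with
period `nS` (equal ideals ⇔ quotient of generators a positive unit ⇔ a power of `ε`), and the chain of `θ(i)⁻¹ I` from `1`
is `k ↦ θ(i)⁻¹ θ(i+k)` (chains rescale). [Voronoi 1896; Delone–Faddeev Ch. IV; Buchmann–Williams 1988 §2]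
[cite: BuchmannWilliams1988, §3 (semantics of the class-group table; supporting lemma)] -/
theorem stub_cubicFilteredCycle :
    ∀ (K : Type) [Field K] [NumberField K], Module.finrank ℚ K = 3 →
    ∀ (σ₁ : K →+* ℝ) (σ₂ : K →+* ℂ), (∃ z : K, starRingEnd ℂ (σ₂ z) ≠ σ₂ z) →
    ∀ (I : FractionalIdeal (𝓞 K)⁰ K), I ≠ 0 → ∀ x₀ : K, x₀ ∈ posRelMinima σ₁ σ₂ I →
    ∃ (s : ℤ → ℤ) (n₀ nS : ℕ) (ε : (𝓞 K)ˣ),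
      0 < n₀ ∧ 1 < σ₁ ((ε : 𝓞 K) : K) ∧ Real.log (σ₁ ((ε : 𝓞 K) : K)) = NumberField.Units.regulator K ∧
      (∀ i, voronoiChain σ₁ σ₂ I x₀ (i + n₀) = ((ε : 𝓞 K) : K) * voronoiChain σ₁ σ₂ I x₀ i) ∧
      (n₀ : ℝ) * Real.log 2 ≤ 6 * NumberField.Units.regulator K ∧
      StrictMono s ∧
      (∀ i, 11 * σ₁ (voronoiChain σ₁ σ₂ I x₀ (s i)) ≤ 10 * σ₁ (voronoiChain σ₁ σ₂ I x₀ (s i + 1))) ∧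
      (∀ j, 11 * σ₁ (voronoiChain σ₁ σ₂ I x₀ j) ≤ 10 * σ₁ (voronoiChain σ₁ σ₂ I x₀ (j + 1)) → ∃ i, s i = j) ∧
      0 ≤ s 0 ∧ (∀ j, 0 ≤ j → 11 * σ₁ (voronoiChain σ₁ σ₂ I x₀ j) ≤ 10 * σ₁ (voronoiChain σ₁ σ₂ I x₀ (j + 1)) → s 0 ≤ j) ∧
      (∀ i, s (i + 1) ≤ s i + 6) ∧
      0 < nS ∧ (∀ i, s (i + nS) = s i + n₀) ∧
      (∀ i, Real.log (11 / 10) ≤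
        Real.log (σ₁ (voronoiChain σ₁ σ₂ I x₀ (s (i + 1)))) - Real.log (σ₁ (voronoiChain σ₁ σ₂ I x₀ (s i)))) ∧
      (∀ i, Real.log (σ₁ (voronoiChain σ₁ σ₂ I x₀ (s (i + 1)))) - Real.log (σ₁ (voronoiChain σ₁ σ₂ I x₀ (s i))) ≤
        6 * Real.log (3 * Real.sqrt |(NumberField.discr K : ℝ)|)) ∧
      (∀ i, (1 : K) ∈ posRelMinima σ₁ σ₂ (FractionalIdeal.spanSingleton (𝓞 K)⁰ (voronoiChain σ₁ σ₂ I x₀ (s i))⁻¹ * I)) ∧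
      (∀ i j, FractionalIdeal.spanSingleton (𝓞 K)⁰ (voronoiChain σ₁ σ₂ I x₀ (s i))⁻¹ * I =
          FractionalIdeal.spanSingleton (𝓞 K)⁰ (voronoiChain σ₁ σ₂ I x₀ (s j))⁻¹ * I ↔ (nS : ℤ) ∣ i - j) ∧
      (∀ (i k : ℤ), voronoiChain σ₁ σ₂ (FractionalIdeal.spanSingleton (𝓞 K)⁰ (voronoiChain σ₁ σ₂ I x₀ i)⁻¹ * I) 1 k =
          (voronoiChain σ₁ σ₂ I x₀ i)⁻¹ * voronoiChain σ₁ σ₂ I x₀ (i + k)) := by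
  intro K _ _ hdeg σ₁ σ₂ hσ₂ I hI x₀ hx₀
  obtain ⟨ε, hε, hreg, -⟩ := stub_regulatorPeriod K hdeg σ₁ σ₂ hσ₂
  have hε' : 1 < σ₁ (algebraMap (𝓞 K) K ε) := hε
  have hε0 : 0 < σ₁ (algebraMap (𝓞 K) K ε) := by linarith
  have hεne : algebraMap (𝓞 K) K ε ≠ 0 := (map_ne_zero σ₁).mp hε0.ne'
  have hreg' : Real.log (σ₁ (algebraMap (𝓞 K) K ε)) = NumberField.Units.regulator K := hreg
  -- (a) the period of the named chain under `ε`
  obtain ⟨c, hc⟩ := voronoiChain_periodic hdeg hσ₂ ε hε' hx₀ ε hε0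
  have hcpos : 0 < c := voronoiChain_shift_pos hdeg hσ₂ ε hε' hx₀ ε hε' hc
  have hcn : ((c.toNat : ℕ) : ℤ) = c := Int.toNat_of_nonneg hcpos.le
  have hmem := fun i => voronoiChain_mem hdeg hσ₂ ε hε' hx₀ i
  have hpos : ∀ i, 0 < σ₁ (voronoiChain σ₁ σ₂ I x₀ i) := fun i => (hmem i).2
  have hmono := voronoiChain_strictMono hdeg hσ₂ ε hε' hx₀
  have h6 : ∀ i, 2 * σ₁ (voronoiChain σ₁ σ₂ I x₀ i) ≤ σ₁ (voronoiChain σ₁ σ₂ I x₀ (i + 6)) :=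
    fun i => voronoiChain_six_gap hdeg hσ₂ ε hε' stub_packing hx₀ i
  have hperK : ∀ i, voronoiChain σ₁ σ₂ I x₀ (i + (c.toNat : ℕ)) =
      algebraMap (𝓞 K) K ε * voronoiChain σ₁ σ₂ I x₀ i := by
    intro i
    rw [hcn]
    exact hc i
  have hper : ∀ i, σ₁ (voronoiChain σ₁ σ₂ I x₀ (i + (c.toNat : ℕ))) =
      σ₁ (algebraMap (𝓞 K) K ε) * σ₁ (voronoiChain σ₁ σ₂ I x₀ i) := by
    intro i
    rw [hperK, map_mul]
  -- the Minkowski one-step bound, with `B = 3 √|d_K| ≥ 1`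
  have hB : (1 : ℝ) ≤ 3 * Real.sqrt |(NumberField.discr K : ℝ)| := by
    have h1 : (1 : ℝ) ≤ Real.sqrt |(NumberField.discr K : ℝ)| := by
      rw [Real.one_le_sqrt]
      have h0 : (1 : ℤ) ≤ |NumberField.discr K| := Int.one_le_abs (NumberField.discr_ne_zero K)
      have : ((1 : ℤ) : ℝ) ≤ ((|NumberField.discr K| : ℤ) : ℝ) := by exact_mod_cast h0
      simpa [Int.cast_abs] using this
    linarith
  have hgap : ∀ i, σ₁ (voronoiChain σ₁ σ₂ I x₀ (i + 1)) ≤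
      3 * Real.sqrt |(NumberField.discr K : ℝ)| * σ₁ (voronoiChain σ₁ σ₂ I x₀ i) :=
    fun i => voronoiChain_gap_le hdeg hσ₂ ε hε' hI hx₀ i
  -- (b) the enumeration of the big-gap indices
  obtain ⟨s, nS, hsm, hbig, hsurj, hs0, hs0min, h6s, hnS, hnSper⟩ :=
    exists_bigGap_enumeration (a := fun i => σ₁ (voronoiChain σ₁ σ₂ I x₀ i)) hpos h6
      (Nat.pos_of_ne_zero (by omega) : 0 < c.toNat) hper
  refine ⟨s, c.toNat, nS, ε, by omega, hε, hreg, hperK, ?_, hsm, hbig, hsurj, hs0, hs0min, h6s, hnS,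
    hnSper, fun i => log_sub_log_ge_of_bigGap hpos hmono hsm hbig i,
    fun i => log_sub_log_le_of_gap_le hpos hB hgap hsm h6s i,
    fun i => one_mem_posRelMinima_inv_mul (hmem (s i)), fun i j => ?_,
    fun i k => voronoiChain_inv_mul hdeg hσ₂ ε hε' hx₀ i k⟩
  · -- `n₀ log 2 ≤ 6 R`
    have h := mul_log_two_le_of_six_gap hpos h6 hper
    rw [hreg'] at h
    exact h
  · -- (e) the labels `θ(s i)⁻¹ I` repeat exactly with period `nS`
    have hsper : ∀ i k : ℤ, s (i + k * nS) = s i + k * c := fun i k => by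
      have h := apply_add_mul_of_forall_apply_add hnSper i k
      rw [hcn] at h
      exact h
    have hθper : ∀ i k : ℤ, voronoiChain σ₁ σ₂ I x₀ (i + k * c) =
        (algebraMap (𝓞 K) K ε) ^ k * voronoiChain σ₁ σ₂ I x₀ i :=
      eq_zpow_mul_of_forall_apply_add hεne hc
    rw [spanSingleton_inv_mul_eq_iff hI (hmem (s j)).1.2.1]
    constructor
    · rintro ⟨u, hu⟩
      have hupos : 0 < σ₁ (algebraMap (𝓞 K) K u) := by
        have h1 := hpos (s j)
        rw [hu, map_mul] at h1
        exact (mul_pos_iff_of_pos_right (hpos (s i))).mp h1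
      obtain ⟨n, hn⟩ := unit_eq_zpow_of_pos hdeg σ₁ σ₂ hσ₂ hε' hreg' u hupos
      have e1 : voronoiChain σ₁ σ₂ I x₀ (s j) = voronoiChain σ₁ σ₂ I x₀ (s (i + n * nS)) := by
        rw [hsper, hθper, ← hn, ← hu]
      have e2 : s j = s (i + n * nS) := hmono.injective (congrArg σ₁ e1)
      have e3 : j = i + n * nS := hsm.injective e2
      exact ⟨-n, by rw [e3]; ring⟩
    · rintro ⟨k, hk⟩
      refine ⟨ε ^ (-k), ?_⟩
      have e3 : j = i + (-k) * nS := by linarith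
      rw [e3, hsper, hθper]
      congr 1
      exact (NumberField.Units.coe_zpow ε (-k)).symm

end Literature.Computability.Cryptography.CubicClassSampling.LinnikStubs

end Part2

/-!
## Part 3 — port of `Summits/QuantumAdvantage/QuantumAdvantage/Theorems/LinnikCubicClassGroupsPureCubicClassGroupFBQPStubSemCircleB.lean` (3 declarations kept)

# `LinnikCubicClassGroups.PureCubicClassGroupFBQP` () — stub `stub_semMain`, part CIRCLE (variant B)

Declarations of this Part (verbatim port; each keeps its own docstring and citation): `fractionalIdeal_eq_of_mem_iff'`, `circle_label_eq_iffB`, `circle_packageB`.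
-/

section Part3

namespace Literature.Computability.Cryptography.CubicClassSampling.LinnikStubs

open scoped _root_.NumberField nonZeroDivisors
open _root_.NumberField
open Literature.NumberTheory.CubicFields
open Literature.NumberTheory.CubicFields.PureCubicCodes (Canon Mem)

section Circle

variable {K : Type} [Field K] [NumberField K] {a b : ℕ} {θ : K} {σ₁ : K →+* ℝ} {σ₂ : K →+* ℂ}
variable (hdeg : Module.finrank ℚ K = 3) (hσ₂ : ∃ z : K, starRingEnd ℂ (σ₂ z) ≠ σ₂ z)
  (hab : Squarefree (a * b)) (hab1 : a * b ≠ 1) (hθ : θ ^ 3 = ((a * b ^ 2 : ℕ) : K))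

omit [NumberField K] in
/-- Fractional ideals with the same elements are equal.
[cite: BuchmannWilliams1988, §3 (semantics of the class-group table; supporting lemma)] -/
private theorem fractionalIdeal_eq_of_mem_iff' {I J : FractionalIdeal (𝓞 K)⁰ K} (h : ∀ φ : K, φ ∈ I ↔ φ ∈ J) : I = J :=
  FractionalIdeal.ext h

include hdeg hσ₂ hab hab1 hθ in
/-- **Exact period of the reduced labels** (`circle_label_eq_iff`, sides swapped). With `θ = voronoiChain A x₀`, `θ(i + n₀) = ε θ(i)` for the regulator unit `ε`
(`log σ₁ ε = R_K`, `σ₁ ε > 1`) and canonical codes `Lab i` of `θ(i)⁻¹ A`: `Lab i = Lab j ↔ n₀ ∣ i − j`.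
[cite: BuchmannWilliams1988, §3 (semantics of the class-group table; supporting lemma)] -/
theorem circle_label_eq_iffB {A : FractionalIdeal (𝓞 K)⁰ K} (hA : A ≠ 0) {x₀ : K} (hx₀ : x₀ ∈ posRelMinima σ₁ σ₂ A)
    {ε : (𝓞 K)ˣ} (hε : 1 < σ₁ (algebraMap (𝓞 K) K ε)) (hreg : Real.log (σ₁ (algebraMap (𝓞 K) K ε)) = Units.regulator K)
    {n₀ : ℕ}
    (hper : ∀ i, voronoiChain σ₁ σ₂ A x₀ (i + n₀) = algebraMap (𝓞 K) K ε * voronoiChain σ₁ σ₂ A x₀ i)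
    {Lab : ℤ → ℕ × List ℤ} (hLab : ∀ i, Canon (Lab i) ∧ ∀ φ : K, Mem θ b (Lab i) φ ↔
      φ ∈ FractionalIdeal.spanSingleton (𝓞 K)⁰ (voronoiChain σ₁ σ₂ A x₀ i)⁻¹ * A) (i j : ℤ) :
    (n₀ : ℤ) ∣ i - j ↔ Lab i = Lab j := by
  refine Iff.symm ?_
  have hε0 : 0 < σ₁ (algebraMap (𝓞 K) K ε) := by linarith
  have hεne : algebraMap (𝓞 K) K ε ≠ 0 := (map_ne_zero σ₁).mp hε0.ne'
  have hmem := fun k => voronoiChain_mem hdeg hσ₂ ε hε hx₀ k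
  have hmono := voronoiChain_strictMono hdeg hσ₂ ε hε hx₀
  have hind := fun c₀ c₁ c₂ h => Literature.NumberTheory.NumberFields.PureCubic.coords_eq_zero (K := K) hdeg hab hab1 hθ
    (c₀ := c₀) (c₁ := c₁) (c₂ := c₂) h
  constructor
  · intro h
    -- equal codes ⇒ equal ideals ⇒ generators differ by a positive unit `ε^q`
    have hIJ : FractionalIdeal.spanSingleton (𝓞 K)⁰ (voronoiChain σ₁ σ₂ A x₀ i)⁻¹ * A =
        FractionalIdeal.spanSingleton (𝓞 K)⁰ (voronoiChain σ₁ σ₂ A x₀ j)⁻¹ * A :=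
      fractionalIdeal_eq_of_mem_iff' fun φ => by rw [← (hLab i).2 φ, ← (hLab j).2 φ, h]
    obtain ⟨u, hu⟩ := (spanSingleton_inv_mul_eq_iff hA (hmem j).1.2.1).mp hIJ
    have hupos : 0 < σ₁ (algebraMap (𝓞 K) K u) := by
      have h1 := (hmem j).2
      rw [hu, map_mul] at h1
      exact (mul_pos_iff_of_pos_right (hmem i).2).mp h1
    obtain ⟨q, hq⟩ := unit_eq_zpow_of_pos hdeg σ₁ σ₂ hσ₂ hε hreg u hupos
    have e1 : voronoiChain σ₁ σ₂ A x₀ j = voronoiChain σ₁ σ₂ A x₀ (i + q * n₀) := by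
      rw [voronoiChain_add_int_mul hεne hper, ← hq, ← hu]
    have e2 : j = i + q * n₀ := hmono.injective (congrArg σ₁ e1)
    exact ⟨-q, by rw [e2]; ring⟩
  · rintro ⟨q, hq⟩
    have e : i = j + q * n₀ := by linarith
    apply PureCubicCodes.canon_unique θ b hind _ _ (hLab i).1 (hLab j).1
    intro φ
    rw [(hLab i).2 φ, (hLab j).2 φ, e, voronoiChain_label_periodic hdeg hσ₂ ε hε hx₀ ε hper]

include hdeg hσ₂ hab hab1 hθ in
/-- **The circle package of an ideal class** (`circle_package`, first two conjuncts swapped). For a nonzero fractional ideal `A` of the pure cubic field there are: a base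
minimum `x₀`, a period `n₀ ≥ 1` (`n₀ log 2 ≤ 6 R_K`) with `log σ₁θ(i + n₀) = log σ₁θ(i) + R_K` along the chain `θ` through
`x₀` (strictly increasing logarithms, gaps `≤ log(3√|d_K|)`), an index function of its cells, canonical codes of the reduced
labels `θ(i)⁻¹ A` repeating exactly with period `n₀`, and the six-gap through every positive minimum of `A`.
[cite: BuchmannWilliams1988, §3 (semantics of the class-group table; supporting lemma)] -/
theorem circle_packageB (A : FractionalIdeal (𝓞 K)⁰ K) (hA : A ≠ 0) :
    ∃ (x₀ : K) (n₀ : ℕ) (idx : ℝ → ℤ) (Lab : ℤ → ℕ × List ℤ) (ε : (𝓞 K)ˣ),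
      0 < n₀ ∧ x₀ ∈ posRelMinima σ₁ σ₂ A ∧ (n₀ : ℝ) * Real.log 2 ≤ 6 * Units.regulator K ∧
      1 < σ₁ (algebraMap (𝓞 K) K ε) ∧ Real.log (σ₁ (algebraMap (𝓞 K) K ε)) = Units.regulator K ∧
      (∀ i, voronoiChain σ₁ σ₂ A x₀ (i + n₀) = algebraMap (𝓞 K) K ε * voronoiChain σ₁ σ₂ A x₀ i) ∧
      StrictMono (fun i => Real.log (σ₁ (voronoiChain σ₁ σ₂ A x₀ i))) ∧
      (∀ i, Real.log (σ₁ (voronoiChain σ₁ σ₂ A x₀ (i + n₀))) = Real.log (σ₁ (voronoiChain σ₁ σ₂ A x₀ i)) + Units.regulator K) ∧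
      (∀ i, Real.log (σ₁ (voronoiChain σ₁ σ₂ A x₀ (i + 1))) - Real.log (σ₁ (voronoiChain σ₁ σ₂ A x₀ i)) ≤
        Real.log (3 * Real.sqrt |(discr K : ℝ)|)) ∧
      (∀ i, 0 < σ₁ (voronoiChain σ₁ σ₂ A x₀ i)) ∧
      (∀ x, Real.log (σ₁ (voronoiChain σ₁ σ₂ A x₀ (idx x))) ≤ x ∧ x < Real.log (σ₁ (voronoiChain σ₁ σ₂ A x₀ (idx x + 1)))) ∧
      (∀ i, Canon (Lab i) ∧ ∀ φ : K, Mem θ b (Lab i) φ ↔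
        φ ∈ FractionalIdeal.spanSingleton (𝓞 K)⁰ (voronoiChain σ₁ σ₂ A x₀ i)⁻¹ * A) ∧
      (∀ i j, Lab i = Lab j ↔ (n₀ : ℤ) ∣ i - j) ∧
      (∀ i, (1 : K) ∈ posRelMinima σ₁ σ₂ (FractionalIdeal.spanSingleton (𝓞 K)⁰ (voronoiChain σ₁ σ₂ A x₀ i)⁻¹ * A)) ∧
      (∀ x₀' ∈ posRelMinima σ₁ σ₂ A, ∀ i,
        2 * σ₁ (voronoiChain σ₁ σ₂ A x₀' i) ≤ σ₁ (voronoiChain σ₁ σ₂ A x₀' (i + 6))) := by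
  classical
  obtain ⟨x₀, hx₀⟩ := posRelMinima_nonempty (σ₁ := σ₁) hdeg hσ₂ hA
  obtain ⟨s, n₀, nS, ε, hn₀, hε, hreg, hper, h6R, -, -, -, -, -, -, -, -, -, -, hone, -, -⟩ :=
    stub_cubicFilteredCycle K hdeg σ₁ σ₂ hσ₂ A hA x₀ hx₀
  have hε' : 1 < σ₁ (algebraMap (𝓞 K) K ε) := hε
  have hε0 : 0 < σ₁ (algebraMap (𝓞 K) K ε) := by linarith
  have hreg' : Real.log (σ₁ (algebraMap (𝓞 K) K ε)) = Units.regulator K := hreg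
  have hper' : ∀ i, voronoiChain σ₁ σ₂ A x₀ (i + n₀) = algebraMap (𝓞 K) K ε * voronoiChain σ₁ σ₂ A x₀ i := hper
  have hmem := fun i => voronoiChain_mem hdeg hσ₂ ε hε' hx₀ i
  have hpos : ∀ i, 0 < σ₁ (voronoiChain σ₁ σ₂ A x₀ i) := fun i => (hmem i).2
  have hmono : StrictMono (fun i => Real.log (σ₁ (voronoiChain σ₁ σ₂ A x₀ i))) := fun i j hij =>
    Real.log_lt_log (hpos i) (voronoiChain_strictMono hdeg hσ₂ ε hε' hx₀ hij)
  have hperlog : ∀ i, Real.log (σ₁ (voronoiChain σ₁ σ₂ A x₀ (i + n₀))) =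
      Real.log (σ₁ (voronoiChain σ₁ σ₂ A x₀ i)) + Units.regulator K := fun i => by
    rw [hper', map_mul, Real.log_mul hε0.ne' (hpos i).ne', hreg']; ring
  obtain ⟨idx, hidx⟩ := chain_exists_indexFn hmono hn₀ hperlog
  -- canonical codes of the reduced labels
  have hlab : ∀ i : ℤ, ∃ c : ℕ × List ℤ, Canon c ∧ ∀ φ : K, Mem θ b c φ ↔
      φ ∈ FractionalIdeal.spanSingleton (𝓞 K)⁰ (voronoiChain σ₁ σ₂ A x₀ i)⁻¹ * A := fun i => by
    refine exists_canon_code hdeg hab hab1 hθ _ ?_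
    refine mul_ne_zero ?_ hA
    rw [Ne, FractionalIdeal.spanSingleton_eq_zero_iff]
    exact inv_ne_zero (hmem i).1.2.1
  choose Lab hLab using hlab
  refine ⟨x₀, n₀, idx, Lab, ε, hn₀, hx₀, h6R, hε', hreg', hper', hmono, hperlog, fun i => ?_, hpos, hidx, hLab,
    fun i j => (circle_label_eq_iffB hdeg hσ₂ hab hab1 hθ hA hx₀ hε' hreg' hper' hLab i j).symm,
    fun i => one_mem_posRelMinima_inv_mul (hmem i),
    fun x₀' hx₀' i => voronoiChain_six_gap hdeg hσ₂ ε hε' stub_packing hx₀' i⟩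
  have h := log_voronoiChain_add_natCast_le hdeg hσ₂ ε hε' hx₀ i 1
  simp only [Nat.cast_one, one_mul] at h
  linarith

end Circle

end Literature.Computability.Cryptography.CubicClassSampling.LinnikStubs

end Part3

/-!
## Part 4 — port of `Summits/QuantumAdvantage/QuantumAdvantage/Theorems/LinnikCubicClassGroupsPureCubicClassGroupFBQPStubRelationLatticeIndex.lean` (4 declarations kept)

# `LinnikCubicClassGroups.PureCubicClassGroupFBQP` () — stub `stub_subgroupOrder`, helper: the relation lattice

Declarations of this Part (verbatim port; each keeps its own docstring and citation): `exists_zpowProd_hom`, `range_zpowProd_hom_eq_closure`, `index_ker_zpowProd_hom_eq_card_closure`, `stub_relationLatticeIndex`.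

Reference keys (see `references.bib` and the declarations' citations): [Hallgren2005].
-/

section Part4

namespace Literature.Computability.Cryptography.CubicClassSampling.LinnikStubs

open scoped _root_.BigOperators

/-- **The exponent homomorphism of a finite family.** For `c : Fin T → G` in a commutative group there is a
group homomorphism `φ : ℤ^T → G` (written multiplicatively on `Multiplicative (Fin T → ℤ)`) with
`φ v = ∏ᵢ cᵢ ^ vᵢ`. [cite: Hallgren2005, §4] -/
theorem exists_zpowProd_hom {G : Type*} [CommGroup G] {T : ℕ} (c : Fin T → G) :
    ∃ φ : Multiplicative (Fin T → ℤ) →* G, ∀ v : Fin T → ℤ, φ (Multiplicative.ofAdd v) = ∏ i, c i ^ v i := by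
  refine ⟨{ toFun := fun v => ∏ i, c i ^ (Multiplicative.toAdd v) i, map_one' := by simp,
            map_mul' := fun v w => ?_ }, fun v => by simp⟩
  simp only [toAdd_mul, Pi.add_apply, zpow_add, Finset.prod_mul_distrib]

/-- **The image of the exponent homomorphism is the generated subgroup**: `φ(ℤ^T) = ⟨c₁, …, c_T⟩`.
[cite: Hallgren2005, §4] -/
theorem range_zpowProd_hom_eq_closure {G : Type*} [CommGroup G] {T : ℕ} (c : Fin T → G)
    (φ : Multiplicative (Fin T → ℤ) →* G) (hφ : ∀ v : Fin T → ℤ, φ (Multiplicative.ofAdd v) = ∏ i, c i ^ v i) :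
    φ.range = Subgroup.closure (Set.range c) := by
  ext x
  rw [MonoidHom.mem_range, Subgroup.mem_closure_range_iff_of_fintype]
  constructor
  · rintro ⟨v, rfl⟩
    exact ⟨Multiplicative.toAdd v, by rw [← hφ]; rfl⟩
  · rintro ⟨a, rfl⟩
    exact ⟨Multiplicative.ofAdd a, hφ a⟩

/-- **Relation-lattice index = order of the generated subgroup.** For the exponent homomorphism `φ` of a
family `c : Fin T → G` in a commutative group, `[ℤ^T : ker φ] = |⟨c₁, …, c_T⟩|` (as natural numbers, with
Mathlib's conventions `index = 0` / `Nat.card = 0` in the infinite case). This is the identity behind the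
output step of `stub_subgroupOrder`: the algorithm computes the index of the relation lattice, the relation
asks for `Nat.card (Subgroup.closure …)`. [cite: Hallgren2005, §4] -/
theorem index_ker_zpowProd_hom_eq_card_closure {G : Type*} [CommGroup G] {T : ℕ} (c : Fin T → G)
    (φ : Multiplicative (Fin T → ℤ) →* G) (hφ : ∀ v : Fin T → ℤ, φ (Multiplicative.ofAdd v) = ∏ i, c i ^ v i) :
    φ.ker.index = Nat.card (Subgroup.closure (Set.range c)) := by
  rw [Subgroup.index_ker, range_zpowProd_hom_eq_closure c φ hφ]

/-- **`stub_relationLatticeIndex`**: the exponent homomorphism of a finite family in a commutative group exists and the index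
of its kernel (the relation lattice) is the order of the generated subgroup. [folklore; Hallgren 2005 §4]
[cite: Hallgren2005, §4] -/
theorem stub_relationLatticeIndex : ∀ (G : Type) [CommGroup G] (T : ℕ) (c : Fin T → G),
      ∃ φ : Multiplicative (Fin T → ℤ) →* G, (∀ v : Fin T → ℤ, φ (Multiplicative.ofAdd v) = ∏ i, c i ^ v i) ∧
        φ.ker.index = Nat.card (Subgroup.closure (Set.range c)) := by
  intro G _ T c
  obtain ⟨φ, hφ⟩ := exists_zpowProd_hom c
  exact ⟨φ, hφ, index_ker_zpowProd_hom_eq_card_closure c φ hφ⟩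

end Literature.Computability.Cryptography.CubicClassSampling.LinnikStubs

end Part4

/-!
## Part 5 — port of `Summits/QuantumAdvantage/QuantumAdvantage/Theorems/LinnikCubicClassGroupsPureCubicClassGroupFBQPStubClassTableSemClasses.lean` (3 declarations kept)

# `LinnikCubicClassGroups.PureCubicClassGroupFBQP` () — stub `stub_classTableSem`, part CLASSES

Declarations of this Part (verbatim port; each keeps its own docstring and citation): `exists_pos_generator`, `log_sub_log_of_spanSingleton_eq`, `classes_package`.
-/

section Part5

namespace Literature.Computability.Cryptography.CubicClassSampling.LinnikStubs

open scoped _root_.NumberField nonZeroDivisors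
open _root_.NumberField
open Literature.NumberTheory.CubicFields

section Classes

variable {K : Type} [Field K] [NumberField K] {σ₁ : K →+* ℝ} {σ₂ : K →+* ℂ}
variable (hdeg : Module.finrank ℚ K = 3) (hσ₂ : ∃ z : K, starRingEnd ℂ (σ₂ z) ≠ σ₂ z)
  {ε : (𝓞 K)ˣ} (hε : 1 < σ₁ (algebraMap (𝓞 K) K ε)) (hreg : Real.log (σ₁ (algebraMap (𝓞 K) K ε)) = Units.regulator K)

/-- A generator of a principal fractional ideal may be taken with positive real conjugate.
[cite: BuchmannWilliams1988, §3 (semantics of the class-group table; supporting lemma)] -/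
theorem exists_pos_generator {I : FractionalIdeal (𝓞 K)⁰ K} (hI : I ≠ 0) {x : K}
    (hx : I = FractionalIdeal.spanSingleton (𝓞 K)⁰ x) :
    ∃ β : K, 0 < σ₁ β ∧ I = FractionalIdeal.spanSingleton (𝓞 K)⁰ β := by
  have hx0 : x ≠ 0 := by rintro rfl; rw [FractionalIdeal.spanSingleton_zero] at hx; exact hI hx
  rcases lt_or_gt_of_ne ((map_ne_zero σ₁).mpr hx0) with h | h
  · refine ⟨-x, by rw [map_neg]; linarith, ?_⟩
    rw [hx]
    have : (-x : K) = ((-1 : (𝓞 K)ˣ) : 𝓞 K) • x := by simp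
    rw [this]
    exact (FractionalIdeal.spanSingleton_eq_spanSingleton.mpr ⟨-1, rfl⟩)
  · exact ⟨x, h, hx⟩

include hdeg hσ₂ hε hreg in
/-- Two positive generators of the same principal ideal have logarithms differing by an integer multiple of `R_K`.
[cite: BuchmannWilliams1988, §3 (semantics of the class-group table; supporting lemma)] -/
theorem log_sub_log_of_spanSingleton_eq {x y : K} (hx : 0 < σ₁ x) (hy : 0 < σ₁ y)
    (h : FractionalIdeal.spanSingleton (𝓞 K)⁰ x = FractionalIdeal.spanSingleton (𝓞 K)⁰ y) :
    ∃ q : ℤ, Real.log (σ₁ y) - Real.log (σ₁ x) = q * Units.regulator K := by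
  obtain ⟨z, hz⟩ := FractionalIdeal.spanSingleton_eq_spanSingleton.mp h
  rw [Units.smul_def, Algebra.smul_def] at hz
  have hzpos : 0 < σ₁ (algebraMap (𝓞 K) K z) := by
    have h1 := hy
    rw [← hz, map_mul] at h1
    exact (mul_pos_iff_of_pos_right hx).mp h1
  obtain ⟨q, hq⟩ := unit_eq_zpow_of_pos hdeg σ₁ σ₂ hσ₂ hε hreg z hzpos
  refine ⟨q, ?_⟩
  have hε0 : 0 < σ₁ (algebraMap (𝓞 K) K ε) := by linarith
  rw [← hz, map_mul, hq, map_zpow₀, Real.log_mul (zpow_pos hε0 q).ne' hx.ne', Real.log_zpow, hreg]; ring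

include hdeg hσ₂ hε hreg in
/-- **The class bookkeeping of the class table.**
[cite: BuchmannWilliams1988, §3 (semantics of the class-group table; supporting lemma)] -/
theorem classes_package (T M : ℕ) (𝔤 : ℕ → Ideal (𝓞 K)) (h𝔤 : ∀ t, t < T → 𝔤 t ≠ ⊥) :
    ∃ (Λ : AddSubgroup (Fin T → ℤ)) (_ : Λ.FiniteIndex) (cls : ℕ → ℕ) (Ag : ℕ → FractionalIdeal (𝓞 K)⁰ K)
      (α : ℕ → K) (lam : Fin T → ℝ),
      Λ.index = Nat.card (Subgroup.closure (Set.range fun t : Fin T =>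
        ClassGroup.mk0 (⟨𝔤 t, mem_nonZeroDivisors_iff_ne_zero.mpr (h𝔤 t t.isLt)⟩ : (Ideal (𝓞 K))⁰))) ∧
      (∀ E E', cls E = cls E' ↔
        (fun t : Fin T => ((E / M ^ (t : ℕ) % M : ℕ) : ℤ) - ((E' / M ^ (t : ℕ) % M : ℕ) : ℤ)) ∈ Λ) ∧
      (∀ g, Ag g ≠ 0) ∧
      (∀ E, 0 < σ₁ (α E) ∧ (∏ t ∈ Finset.range T, ((𝔤 t : Ideal (𝓞 K)) : FractionalIdeal (𝓞 K)⁰ K) ^ (E / M ^ t % M)) =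
        FractionalIdeal.spanSingleton (𝓞 K)⁰ (α E) * Ag (cls E)) ∧
      (∀ E E', cls E = cls E' → ∃ z : ℤ, Real.log (σ₁ (α E')) - Real.log (σ₁ (α E)) -
        ∑ t : Fin T, lam t * (((E' / M ^ (t : ℕ) % M : ℕ) : ℝ) - ((E / M ^ (t : ℕ) % M : ℕ) : ℝ)) = z * Units.regulator K) ∧
      (∀ E E' (x x' : K), x ≠ 0 → x' ≠ 0 →
        FractionalIdeal.spanSingleton (𝓞 K)⁰ x * Ag (cls E) = FractionalIdeal.spanSingleton (𝓞 K)⁰ x' * Ag (cls E') →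
        cls E = cls E') := by
  classical
  set G := ClassGroup (𝓞 K) with hG
  set g0 : Fin T → (Ideal (𝓞 K))⁰ := fun t => ⟨𝔤 t, mem_nonZeroDivisors_iff_ne_zero.mpr (h𝔤 t t.isLt)⟩ with hg0
  set uI : Fin T → (FractionalIdeal (𝓞 K)⁰ K)ˣ := fun t => FractionalIdeal.mk0 K (g0 t) with huI
  set c : Fin T → G := fun t => ClassGroup.mk0 (g0 t) with hc
  have hcmk : ∀ t, ClassGroup.mk K (uI t) = c t := fun t => ClassGroup.mk_mk0 K (g0 t)
  obtain ⟨φ, hφ, hidx⟩ := stub_relationLatticeIndex G T c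
  set Λ : AddSubgroup (Fin T → ℤ) := AddSubgroup.toSubgroup.symm φ.ker with hΛ
  have hmemΛ : ∀ v, v ∈ Λ ↔ ∏ t, c t ^ v t = 1 := fun v => by
    change Multiplicative.ofAdd v ∈ φ.ker ↔ _
    rw [MonoidHom.mem_ker, hφ]
  have hΛidx : Λ.index = φ.ker.index := by
    rw [← AddSubgroup.index_toSubgroup, hΛ, OrderIso.apply_symm_apply]
  haveI hfin : Λ.FiniteIndex := by
    refine ⟨?_⟩
    rw [hΛidx, hidx]
    exact Nat.card_pos.ne'
  -- unit products and their classes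
  set U : (Fin T → ℤ) → (FractionalIdeal (𝓞 K)⁰ K)ˣ := fun v => ∏ t, uI t ^ v t with hU
  have hUmk : ∀ v, ClassGroup.mk K (U v) = ∏ t, c t ^ v t := fun v => by
    rw [hU, map_prod]; simp_rw [map_zpow, hcmk]
  have hUadd : ∀ v w, U (v + w) = U v * U w := fun v w => by
    rw [hU, ← Finset.prod_mul_distrib]
    exact Finset.prod_congr rfl fun t _ => by rw [Pi.add_apply, zpow_add]
  set d : ℕ → Fin T → ℤ := fun E t => ((E / M ^ (t : ℕ) % M : ℕ) : ℤ) with hd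
  have hUcoe : ∀ E, (U (d E) : FractionalIdeal (𝓞 K)⁰ K) =
      ∏ t ∈ Finset.range T, ((𝔤 t : Ideal (𝓞 K)) : FractionalIdeal (𝓞 K)⁰ K) ^ (E / M ^ t % M) := by
    intro E
    rw [hU, Units.coe_prod, ← Fin.prod_univ_eq_prod_range (fun t => ((𝔤 t : Ideal (𝓞 K)) : FractionalIdeal (𝓞 K)⁰ K) ^ (E / M ^ t % M))]
    refine Finset.prod_congr rfl fun t _ => ?_
    rw [hd, Units.val_zpow_eq_zpow_val, zpow_natCast, huI, FractionalIdeal.coe_mk0]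
  -- classes
  set eqv := Fintype.equivFin G with heqv
  set clsG : ℕ → G := fun E => ClassGroup.mk K (U (d E)) with hclsG
  set cls : ℕ → ℕ := fun E => ((eqv (clsG E) : Fin _) : ℕ) with hcls
  have hcls_iff : ∀ E E', cls E = cls E' ↔ clsG E = clsG E' := fun E E' =>
    Fin.val_injective.eq_iff.trans eqv.injective.eq_iff
  have hclsG_iff : ∀ E E', clsG E = clsG E' ↔ (d E - d E') ∈ Λ := fun E E' => by
    rw [hmemΛ, ← hUmk, show d E - d E' = d E + (-(d E')) by ring, hUadd, map_mul]
    have hneg : U (-(d E')) = (U (d E'))⁻¹ := by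
      rw [hU, ← Finset.prod_inv_distrib]
      exact Finset.prod_congr rfl fun t _ => by rw [Pi.neg_apply, zpow_neg]
    rw [hneg, map_inv, mul_inv_eq_one]
  -- representatives
  have hsurj := ClassGroup.mk0_surjective (R := 𝓞 K)
  set rep0 : ℕ → (Ideal (𝓞 K))⁰ := fun g =>
    if h : g < Fintype.card G then Classical.choose (hsurj (eqv.symm ⟨g, h⟩)) else 1 with hrep0
  set Ag : ℕ → FractionalIdeal (𝓞 K)⁰ K := fun g => ((rep0 g : Ideal (𝓞 K)) : FractionalIdeal (𝓞 K)⁰ K) with hAg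
  have hAg0 : ∀ g, Ag g ≠ 0 := fun g =>
    FractionalIdeal.coeIdeal_ne_zero.mpr (nonZeroDivisors.ne_zero (rep0 g).2)
  have hAgmk : ∀ g, (FractionalIdeal.mk0 K (rep0 g) : FractionalIdeal (𝓞 K)⁰ K) = Ag g := fun g =>
    FractionalIdeal.coe_mk0 K _
  have hrep : ∀ E, ClassGroup.mk K (FractionalIdeal.mk0 K (rep0 (cls E))) = clsG E := fun E => by
    rw [ClassGroup.mk_mk0]
    have h : cls E < Fintype.card G := (eqv (clsG E)).isLt
    have e : rep0 (cls E) = Classical.choose (hsurj (eqv.symm ⟨cls E, h⟩)) := by rw [hrep0]; exact dif_pos h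
    rw [e, Classical.choose_spec (hsurj (eqv.symm ⟨cls E, h⟩))]
    change eqv.symm ⟨((eqv (clsG E) : Fin _) : ℕ), h⟩ = clsG E
    rw [Fin.eta, Equiv.symm_apply_apply]
  have hrep_inj : ∀ E E', ClassGroup.mk K (FractionalIdeal.mk0 K (rep0 (cls E))) =
      ClassGroup.mk K (FractionalIdeal.mk0 K (rep0 (cls E'))) → cls E = cls E' := fun E E' h => by
    rw [hrep, hrep] at h; exact (hcls_iff E E').2 h
  -- positive multipliers `α_E`
  have hαex : ∀ E, ∃ α : K, 0 < σ₁ α ∧ (U (d E) : FractionalIdeal (𝓞 K)⁰ K) =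
      FractionalIdeal.spanSingleton (𝓞 K)⁰ α * Ag (cls E) := by
    intro E
    have h1 : ClassGroup.mk K (U (d E) * (FractionalIdeal.mk0 K (rep0 (cls E)))⁻¹) = 1 := by
      rw [map_mul, map_inv, hrep, hclsG, mul_inv_cancel]
    rw [ClassGroup.mk_eq_one_iff] at h1
    obtain ⟨x, hx⟩ := (FractionalIdeal.isPrincipal_iff _).1 h1
    have hP0 : ((U (d E) * (FractionalIdeal.mk0 K (rep0 (cls E)))⁻¹ : (FractionalIdeal (𝓞 K)⁰ K)ˣ) :
        FractionalIdeal (𝓞 K)⁰ K) ≠ 0 := Units.ne_zero _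
    obtain ⟨β, hβ, hβeq⟩ := exists_pos_generator (σ₁ := σ₁) hP0 hx
    refine ⟨β, hβ, ?_⟩
    have h2 := congrArg (fun J : FractionalIdeal (𝓞 K)⁰ K => J * Ag (cls E)) hβeq
    rw [← h2, Units.val_mul, Units.val_inv_eq_inv_val, hAgmk, mul_assoc, inv_mul_cancel₀ (hAg0 _), mul_one]
  choose α hαpos hαeq using hαex
  -- the distance homomorphism of `Λ`
  have hβex : ∀ v : Fin T → ℤ, ∃ β : K, v ∈ Λ →
      (0 < σ₁ β ∧ (U v : FractionalIdeal (𝓞 K)⁰ K) = FractionalIdeal.spanSingleton (𝓞 K)⁰ β) := by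
    intro v
    by_cases hv : v ∈ Λ
    · have h1 : ClassGroup.mk K (U v) = 1 := by rw [hUmk]; exact (hmemΛ v).1 hv
      rw [ClassGroup.mk_eq_one_iff] at h1
      obtain ⟨x, hx⟩ := (FractionalIdeal.isPrincipal_iff _).1 h1
      obtain ⟨β, hβ, hβeq⟩ := exists_pos_generator (σ₁ := σ₁) (Units.ne_zero _) hx
      exact ⟨β, fun _ => ⟨hβ, hβeq⟩⟩
    · exact ⟨1, fun h => absurd h hv⟩
  choose β hβ using hβex
  set f : (Fin T → ℤ) → ℝ := fun v => Real.log (σ₁ (β v)) with hf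
  have hfadd : ∀ v ∈ Λ, ∀ w ∈ Λ, ∃ z : ℤ, f (v + w) - f v - f w = z * Units.regulator K := by
    intro v hv w hw
    obtain ⟨hv1, hv2⟩ := hβ v hv
    obtain ⟨hw1, hw2⟩ := hβ w hw
    obtain ⟨hvw1, hvw2⟩ := hβ (v + w) (Λ.add_mem hv hw)
    have heq : FractionalIdeal.spanSingleton (𝓞 K)⁰ (β v * β w) = FractionalIdeal.spanSingleton (𝓞 K)⁰ (β (v + w)) := by
      rw [← hvw2, hUadd, Units.val_mul, hv2, hw2, FractionalIdeal.spanSingleton_mul_spanSingleton]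
    obtain ⟨q, hq⟩ := log_sub_log_of_spanSingleton_eq hdeg hσ₂ hε hreg (by rw [map_mul]; exact mul_pos hv1 hw1) hvw1 heq
    refine ⟨q, ?_⟩
    change Real.log (σ₁ (β (v + w))) - Real.log (σ₁ (β v)) - Real.log (σ₁ (β w)) = q * Units.regulator K
    rw [map_mul, Real.log_mul hv1.ne' hw1.ne'] at hq
    linarith
  obtain ⟨lam, hlam⟩ := exists_linear_lift_mod Λ (Units.regulator K) f hfadd
  refine ⟨Λ, hfin, cls, Ag, α, lam, by change Λ.index = Nat.card (Subgroup.closure (Set.range c)); rw [hΛidx, hidx], fun E E' => (hcls_iff E E').trans (hclsG_iff E E'), hAg0,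
    fun E => ⟨hαpos E, by rw [← hUcoe]; exact hαeq E⟩, fun E E' hEE' => ?_, fun E E' x x' hx hx' h => ?_⟩
  · -- exact affinity along a class
    set v : Fin T → ℤ := d E' - d E with hv
    have hvΛ : v ∈ Λ := (hclsG_iff E' E).1 ((hcls_iff E' E).1 hEE'.symm)
    obtain ⟨hv1, hv2⟩ := hβ v hvΛ
    have hUE' : U (d E') = U (d E) * U v := by rw [← hUadd]; congr 1; rw [hv]; abel
    have h1 : (U (d E') : FractionalIdeal (𝓞 K)⁰ K) = FractionalIdeal.spanSingleton (𝓞 K)⁰ (α E') * Ag (cls E) := by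
      rw [hEE']; exact hαeq E'
    have hideal : FractionalIdeal.spanSingleton (𝓞 K)⁰ (α E') * Ag (cls E) =
        FractionalIdeal.spanSingleton (𝓞 K)⁰ (α E * β v) * Ag (cls E) := by
      rw [← h1, hUE', Units.val_mul, hαeq E, hv2, ← FractionalIdeal.spanSingleton_mul_spanSingleton]
      ring
    have hcancel : FractionalIdeal.spanSingleton (𝓞 K)⁰ (α E * β v) = FractionalIdeal.spanSingleton (𝓞 K)⁰ (α E') :=
      (mul_right_cancel₀ (hAg0 _) hideal).symm
    obtain ⟨q, hq⟩ := log_sub_log_of_spanSingleton_eq hdeg hσ₂ hε hreg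
      (by rw [map_mul]; exact mul_pos (hαpos E) hv1) (hαpos E') hcancel
    obtain ⟨z, hz⟩ := hlam v hvΛ
    refine ⟨q + z, ?_⟩
    rw [map_mul, Real.log_mul (hαpos E).ne' hv1.ne'] at hq
    have hsum : ∑ t : Fin T, lam t * (((E' / M ^ (t : ℕ) % M : ℕ) : ℝ) - ((E / M ^ (t : ℕ) % M : ℕ) : ℝ)) =
        ∑ t, lam t * (v t : ℝ) := Finset.sum_congr rfl fun t _ => by
          simp only [hv, hd, Pi.sub_apply, Int.cast_sub, Int.cast_natCast]
    rw [hsum]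
    have hf' : f v = Real.log (σ₁ (β v)) := rfl
    push_cast
    linarith
  · -- class representatives with a common multiple lie in one class
    apply hrep_inj
    rw [ClassGroup.mk_mk0, ClassGroup.mk_mk0]
    apply (ClassGroup.mk0_eq_mk0_iff).2
    -- from `(x) A_g = (x') A_g'` in `K`, clear denominators
    obtain ⟨nx, mx, hmx, hnx⟩ := IsFractionRing.div_surjective (A := 𝓞 K) x
    obtain ⟨nx', mx', hmx', hnx'⟩ := IsFractionRing.div_surjective (A := 𝓞 K) x'
    have hmx0 : algebraMap (𝓞 K) K mx ≠ 0 := RingOfIntegers.coe_ne_zero_iff.mpr (nonZeroDivisors.ne_zero hmx)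
    have hmx'0 : algebraMap (𝓞 K) K mx' ≠ 0 := RingOfIntegers.coe_ne_zero_iff.mpr (nonZeroDivisors.ne_zero hmx')
    have hnx0 : nx ≠ 0 := by
      rintro rfl; rw [map_zero, zero_div] at hnx; exact hx hnx.symm
    have hnx'0 : nx' ≠ 0 := by
      rintro rfl; rw [map_zero, zero_div] at hnx'; exact hx' hnx'.symm
    refine ⟨nx * mx', nx' * mx, mul_ne_zero hnx0 (nonZeroDivisors.ne_zero hmx'), mul_ne_zero hnx'0 (nonZeroDivisors.ne_zero hmx), ?_⟩
    rw [← FractionalIdeal.coeIdeal_inj (K := K), FractionalIdeal.coeIdeal_mul, FractionalIdeal.coeIdeal_mul,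
      FractionalIdeal.coeIdeal_span_singleton, FractionalIdeal.coeIdeal_span_singleton]
    change FractionalIdeal.spanSingleton (𝓞 K)⁰ (algebraMap (𝓞 K) K (nx * mx')) * Ag (cls E) =
      FractionalIdeal.spanSingleton (𝓞 K)⁰ (algebraMap (𝓞 K) K (nx' * mx)) * Ag (cls E')
    have ex : algebraMap (𝓞 K) K (nx * mx') = x * (algebraMap (𝓞 K) K mx * algebraMap (𝓞 K) K mx') := by
      rw [map_mul, ← hnx]; field_simp
    have ex' : algebraMap (𝓞 K) K (nx' * mx) = x' * (algebraMap (𝓞 K) K mx * algebraMap (𝓞 K) K mx') := by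
      rw [map_mul, ← hnx']; field_simp
    rw [ex, ex']
    have h' := congrArg (fun J => J * FractionalIdeal.spanSingleton (𝓞 K)⁰ (algebraMap (𝓞 K) K mx * algebraMap (𝓞 K) K mx')) h
    simp only [mul_right_comm _ (Ag _), FractionalIdeal.spanSingleton_mul_spanSingleton] at h'
    exact h'

end Classes

end Literature.Computability.Cryptography.CubicClassSampling.LinnikStubs

end Part5

/-!
## Part 6 — port of `Summits/QuantumAdvantage/QuantumAdvantage/Theorems/LinnikCubicClassGroupsPureCubicClassGroupFBQPStubClassTableSemCells.lean` (2 declarations kept)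

# `LinnikCubicClassGroups.PureCubicClassGroupFBQP` () — stub `stub_classTableSem`, part CELLS

Declarations of this Part (verbatim port; each keeps its own docstring and citation): `num_ncell`, `cells_package`.
-/

section Part6

namespace Literature.Computability.Cryptography.CubicClassSampling.LinnikStubs

open Literature.NumberTheory.CubicFields

/-- **The cell count, numerically**: `2^npp (R + LB) + n₀ + 1 ≤ 2^(npp+5) (27a²b²)^6`.
[cite: BuchmannWilliams1988, §3 (semantics of the class-group table; supporting lemma)] -/
theorem num_ncell {npp n₀ a b : ℕ} {R LB d : ℝ} (hLB0 : 0 ≤ LB) (hLB : LB ≤ d ^ 6) (hRd : R ≤ d ^ 6)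
    (hn₀R : (n₀ : ℝ) * Real.log 2 ≤ 6 * R) (hd : 1 ≤ d) (hdab : d ≤ 27 * (a : ℝ) ^ 2 * (b : ℝ) ^ 2) :
    2 ^ npp * (R + LB) + n₀ + 1 ≤ ((2 ^ (npp + 5) * (27 * a ^ 2 * b ^ 2) ^ 6 : ℕ) : ℝ) := by
  have hl2 := Real.log_two_gt_d9
  have hd6 : (1 : ℝ) ≤ d ^ 6 := one_le_pow₀ hd
  have hn₀ : (n₀ : ℝ) ≤ 9 * d ^ 6 := by nlinarith
  have hpow : d ^ 6 ≤ (27 * (a : ℝ) ^ 2 * (b : ℝ) ^ 2) ^ 6 := pow_le_pow_left₀ (by linarith) hdab 6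
  have h2 : (1 : ℝ) ≤ 2 ^ npp := one_le_pow₀ (by norm_num)
  push_cast
  rw [pow_add]
  nlinarith [mul_le_mul_of_nonneg_left hpow (by positivity : (0 : ℝ) ≤ 2 ^ npp)]

/-- **Clause (vi) for one class circle.**
[cite: BuchmannWilliams1988, §3 (semantics of the class-group table; supporting lemma)] -/
theorem cells_package {G : ℤ → ℝ} (hG : StrictMono G) {n₀ : ℕ} (hn₀ : 0 < n₀) {R : ℝ} (hper : ∀ i, G (i + n₀) = G i + R)
    {idx : ℝ → ℤ} (hidx : ∀ x, G (idx x) ≤ x ∧ x < G (idx x + 1)) {Lab : ℤ → ℕ × List ℤ}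
    (hLab : ∀ i j, Lab i = Lab j ↔ (n₀ : ℤ) ∣ i - j) (s npp : ℕ) {LB d : ℝ} (hgap : ∀ k, G (k + 1) - G k ≤ LB)
    (hLB0 : 0 ≤ LB) (hLB : LB ≤ d ^ 6) (hRd : R ≤ d ^ 6) (hn₀R : (n₀ : ℝ) * Real.log 2 ≤ 6 * R) (hd : 1 ≤ d)
    {a b : ℕ} (hdab : d ≤ 27 * (a : ℝ) ^ 2 * (b : ℝ) ^ 2) :
    (∀ ω ∈ (Finset.range (2 ^ s)).image (fun i : ℕ => (Lab (idx (i * (R / ((2 ^ s : ℕ) : ℝ)))),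
        ⌊(i * (R / ((2 ^ s : ℕ) : ℝ)) - G (idx (i * (R / ((2 ^ s : ℕ) : ℝ))))) * (2 : ℝ) ^ npp⌋₊)),
      ∃ b₁ b₂ b₁' b₂' : ℕ, Disjoint (Finset.Ico b₁ b₂) (Finset.Ico b₁' b₂') ∧
        (Finset.range (2 ^ s)).filter (fun i : ℕ => (Lab (idx (i * (R / ((2 ^ s : ℕ) : ℝ)))),
          ⌊(i * (R / ((2 ^ s : ℕ) : ℝ)) - G (idx (i * (R / ((2 ^ s : ℕ) : ℝ))))) * (2 : ℝ) ^ npp⌋₊) = ω) =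
          Finset.Ico b₁ b₂ ∪ Finset.Ico b₁' b₂') ∧
    ((Finset.range (2 ^ s)).image (fun i : ℕ => (Lab (idx (i * (R / ((2 ^ s : ℕ) : ℝ)))),
        ⌊(i * (R / ((2 ^ s : ℕ) : ℝ)) - G (idx (i * (R / ((2 ^ s : ℕ) : ℝ))))) * (2 : ℝ) ^ npp⌋₊))).card ≤
      2 ^ (npp + 5) * (27 * a ^ 2 * b ^ 2) ^ 6 := by
  classical
  have hN : (0 : ℝ) < (2 : ℝ) ^ npp := by positivity
  have hS : 0 < 2 ^ s := by positivity
  refine ⟨fun ω _ => cell_grid_fibre_two_runs hG hn₀ hper hidx hLab hN hS ω, ?_⟩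
  have h := cell_grid_image_card_le hG hn₀ hper hidx (Lab := Lab) hN hS hgap
  have h2 := num_ncell (npp := npp) (n₀ := n₀) (a := a) (b := b) hLB0 hLB hRd hn₀R hd hdab
  exact_mod_cast h.trans h2

end Literature.Computability.Cryptography.CubicClassSampling.LinnikStubs

end Part6

/-!
## Part 7 — port of `Summits/QuantumAdvantage/QuantumAdvantage/Theorems/LinnikCubicClassGroupsPureCubicClassGroupFBQPStubClassTableSemCoins.lean` (2 declarations kept)

# `LinnikCubicClassGroups.PureCubicClassGroupFBQP` () — stub `stub_classTableSem`, part COINS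

Declarations of this Part (verbatim port; each keeps its own docstring and citation): `num_badcoins`, `coins_clause`.
-/

section Part7

namespace Literature.Computability.Cryptography.CubicClassSampling.LinnikStubs

open Literature.Computability.Cryptography
open Literature.Computability.Cryptography.CubicClassTable
open Literature.Computability.Complexity (uniformProb)

/-- `n 2^-(9 + size n) ≤ 1`... precisely `n (1/2)^(49+e+size n) ≤ (1/2)^(40+e)`.
[cite: BuchmannWilliams1988, §3 (semantics of the class-group table; supporting lemma)] -/
theorem num_badcoins (n e : ℕ) : (n : ℝ) * (1 / 2) ^ (49 + e + Nat.size n) ≤ (1 / 2) ^ (40 + e) := by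
  have hn : (n : ℝ) < 2 ^ Nat.size n := by exact_mod_cast Nat.lt_size_self n
  have e1 : ((1 : ℝ) / 2) ^ (49 + e + Nat.size n) = (1 / 2) ^ (40 + e) * ((1 / 2) ^ 9 * (1 / 2) ^ Nat.size n) := by
    rw [← pow_add, ← pow_add]; congr 1; omega
  rw [e1]
  have h2 : (n : ℝ) * ((1 / 2) ^ 9 * (1 / 2) ^ Nat.size n) ≤ 1 := by
    have hp : ((1 : ℝ) / 2) ^ Nat.size n * 2 ^ Nat.size n = 1 := by
      rw [div_pow, one_pow, div_mul_cancel₀ _ (by positivity)]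
    have h0 : (0 : ℝ) ≤ (1 / 2) ^ Nat.size n := by positivity
    have h1 : (n : ℝ) * (1 / 2) ^ Nat.size n ≤ 1 := by nlinarith [mul_le_mul_of_nonneg_right hn.le h0]
    have h9 : ((1 : ℝ) / 2) ^ 9 ≤ 1 := by norm_num
    calc (n : ℝ) * ((1 / 2) ^ 9 * (1 / 2) ^ Nat.size n) = (1 / 2) ^ 9 * ((n : ℝ) * (1 / 2) ^ Nat.size n) := by ring
      _ ≤ 1 * 1 := mul_le_mul h9 h1 (by positivity) zero_le_one
      _ = 1 := one_mul _
  calc (n : ℝ) * ((1 / 2) ^ (40 + e) * ((1 / 2) ^ 9 * (1 / 2) ^ Nat.size n))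
      = (1 / 2) ^ (40 + e) * ((n : ℝ) * ((1 / 2) ^ 9 * (1 / 2) ^ Nat.size n)) := by ring
    _ ≤ (1 / 2) ^ (40 + e) * 1 := mul_le_mul_of_nonneg_left h2 (by positivity)
    _ = (1 / 2) ^ (40 + e) := mul_one _

open scoped _root_.Classical in
/-- **Clause (ii): the coins.** For the instance `I` and the bundle `F'` obtained from `F` by replacing the root program with the
true cube roots: the bad coin values are few and off them the table of `F` is the table of `F'` at the reduced position.
[cite: BuchmannWilliams1988, §3 (semantics of the class-group table; supporting lemma)] -/
theorem coins_clause (F : WalkFns) (I : Inst) (cap e : ℕ) (hroots : RootsSem F)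
    (hps : ∀ p ∈ I.ps, p.Prime ∧ ¬ p ∣ 3 * I.m) (hpcap : ∀ p ∈ I.ps, p ≤ cap)
    (hℓb : I.ℓb = 24 * (Nat.size cap + 2) * (50 + e + Nat.size I.ps.length)) (hℓκ : I.ps.length * I.ℓb ≤ I.ℓκ) :
    ((((Finset.range (2 ^ I.ℓκ)).filter (fun κ => ∃ i < I.ps.length,
        F.roots (I.ps.getD i 0, I.m, List.ofFn fun q : Fin I.ℓb => Nat.testBit κ (i * I.ℓb + q)) ≠
          (List.range (I.ps.getD i 0)).filter (fun r => r ^ 3 % I.ps.getD i 0 = I.m % I.ps.getD i 0))).card : ℕ) : ℝ) ≤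
        (1 / 2) ^ (40 + e) * 2 ^ I.ℓκ ∧
      ∀ v : ℕ, (v / (I.W * 2 ^ I.ℓy)) % 2 ^ I.ℓκ ∉ (Finset.range (2 ^ I.ℓκ)).filter (fun κ => ∃ i < I.ps.length,
        F.roots (I.ps.getD i 0, I.m, List.ofFn fun q : Fin I.ℓb => Nat.testBit κ (i * I.ℓb + q)) ≠
          (List.range (I.ps.getD i 0)).filter (fun r => r ^ 3 % I.ps.getD i 0 = I.m % I.ps.getD i 0)) →
        F.classTableOpQ I cap v =
          ({ F with roots := fun x => (List.range x.1).filter (fun r => r ^ 3 % x.1 = x.2.1 % x.1) } : WalkFns).classTableOpQ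
            I cap (v % (I.W * 2 ^ I.ℓy)) := by
  set good : ℕ → List ℕ := fun p => (List.range p).filter (fun r => r ^ 3 % p = I.m % p) with hgood
  set F' : WalkFns := { F with roots := fun x => (List.range x.1).filter (fun r => r ^ 3 % x.1 = x.2.1 % x.1) } with hF'
  constructor
  · -- (a) few bad coin values
    set s' : ℕ := 49 + e + Nat.size I.ps.length with hs'
    have hper : ∀ i < I.ps.length, uniformProb I.ℓb {κ | F.roots (I.ps.getD i 0, I.m, κ) ≠ good (I.ps.getD i 0)} ≤ (1 / 2) ^ s' := by
      intro i hi
      have hpi : I.ps.getD i 0 ∈ I.ps := by rw [List.getD_eq_getElem _ _ hi]; exact List.getElem_mem hi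
      obtain ⟨hp, hpd⟩ := hps _ hpi
      refine hroots (I.ps.getD i 0) I.m hp hpd s' I.ℓb ?_
      have hsz : Nat.size (I.ps.getD i 0) ≤ Nat.size cap := Nat.size_le_size (hpcap _ hpi)
      rw [hℓb, hs']
      calc (49 + e + Nat.size I.ps.length + 1) * (24 * (Nat.size (I.ps.getD i 0) + 2))
          = 24 * (Nat.size (I.ps.getD i 0) + 2) * (50 + e + Nat.size I.ps.length) := by ring
        _ ≤ 24 * (Nat.size cap + 2) * (50 + e + Nat.size I.ps.length) := by gcongr
    have h := card_badCoins_le F.roots good I.ps I.m I.ℓκ I.ℓb s' hℓκ hper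
    refine h.trans ?_
    have := num_badcoins I.ps.length e
    rw [← hs'] at this
    nlinarith [show (0 : ℝ) ≤ 2 ^ I.ℓκ by positivity]
  · -- (b) off the bad set the table is the coin-free table at the reduced position
    intro v hv
    rw [Finset.mem_filter, not_and] at hv
    have hκ : I.κof v < 2 ^ I.ℓκ := Nat.mod_lt _ (by positivity)
    have hv' := hv (Finset.mem_range.mpr hκ)
    push Not at hv'
    have hr : ∀ i < I.ps.length, F.roots (I.ps.getD i 0, I.m, I.coins v i) =
        F'.roots (I.ps.getD i 0, I.m, I.coins (v % (I.W * 2 ^ I.ℓy)) i) := by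
      intro i hi
      have h := hv' i hi
      exact h
    refine WalkFns.classTableOpQ_congr_gens (F := F) (F' := F') rfl rfl cap
      (WalkFns.gT_congr_roots (F := F) (F' := F') (I := I) rfl hr) ?_ ?_
    · unfold Inst.Eof; rw [Nat.mod_mul_right_mod]
    · unfold Inst.jof; rw [Nat.mod_mul_right_div_self, Nat.mod_mod]

end Literature.Computability.Cryptography.CubicClassSampling.LinnikStubs

end Part7

/-!
## Part 8 — port of `Summits/QuantumAdvantage/QuantumAdvantage/Theorems/LinnikCubicClassGroupsPureCubicClassGroupFBQPStubClassTableSemIndex.lean` (2 declarations kept)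

# `LinnikCubicClassGroups.PureCubicClassGroupFBQP` () — stub `stub_classTableSem`, part INDEX

Declarations of this Part (verbatim port; each keeps its own docstring and citation): `closure_slots_eq`, `defects_biUnion`.
-/

section Part8

namespace Literature.Computability.Cryptography.CubicClassSampling.LinnikStubs

open scoped _root_.NumberField nonZeroDivisors
open _root_.NumberField

/-- **The slot classes generate the subgroup of the degree-one primes above `ps`.**
[cite: BuchmannWilliams1988, §3 (semantics of the class-group table; supporting lemma)] -/
theorem closure_slots_eq {K : Type} [Field K] [NumberField K] {T : ℕ} (𝔤 : ℕ → Ideal (𝓞 K))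
    (h𝔤 : ∀ t, t < T → 𝔤 t ≠ ⊥) (ps : List ℕ)
    (hkind : ∀ t, t < T → 𝔤 t = ⊤ ∨ ((𝔤 t).IsPrime ∧ Ideal.absNorm (𝔤 t) ∈ ps))
    (hall : ∀ p ∈ ps, ∀ Q : Ideal (𝓞 K), Q.IsPrime → Ideal.absNorm Q = p → ∃ t, t < T ∧ 𝔤 t = Q) :
    Subgroup.closure (Set.range fun t : Fin T =>
        ClassGroup.mk0 (⟨𝔤 t, mem_nonZeroDivisors_iff_ne_zero.mpr (h𝔤 t t.isLt)⟩ : (Ideal (𝓞 K))⁰)) =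
      Subgroup.closure {c : ClassGroup (𝓞 K) | ∃ p ∈ ps, ∃ P : Ideal (𝓞 K), ∃ hP : P ∈ nonZeroDivisors (Ideal (𝓞 K)),
        P.IsPrime ∧ Ideal.absNorm P = p ∧ c = ClassGroup.mk0 ⟨P, hP⟩} := by
  apply le_antisymm
  · rw [Subgroup.closure_le]
    rintro c ⟨t, rfl⟩
    rcases hkind t t.isLt with htop | ⟨hpr, hmem⟩
    · have h1 : (⟨𝔤 t, mem_nonZeroDivisors_iff_ne_zero.mpr (h𝔤 t t.isLt)⟩ : (Ideal (𝓞 K))⁰) = 1 := by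
        apply Subtype.ext; simp only [OneMemClass.coe_one]; rw [Ideal.one_eq_top]; exact htop
      simp only [h1, map_one]
      exact (Subgroup.closure _).one_mem
    · exact Subgroup.subset_closure ⟨_, hmem, 𝔤 t, mem_nonZeroDivisors_iff_ne_zero.mpr (h𝔤 t t.isLt), hpr, rfl, rfl⟩
  · rw [Subgroup.closure_le]
    rintro c ⟨p, hp, P, hP, hpr, hnorm, rfl⟩
    obtain ⟨t, ht, htP⟩ := hall p hp P hpr hnorm
    refine Subgroup.subset_closure ⟨⟨t, ht⟩, ?_⟩
    simp only
    congr 1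
    exact Subtype.ext htP

/-- **The global defect set from per-block bad sets.**
[cite: BuchmannWilliams1988, §3 (semantics of the class-group table; supporting lemma)] -/
theorem defects_biUnion {W : ℕ} (hW : 0 < W) (B : ℕ → Finset ℕ) {c : ℝ} (hB : ∀ E, E < W → ((B E).card : ℝ) ≤ c) :
    ((((Finset.range W).biUnion (fun E => (B E).image (fun j => E + W * j))).card : ℕ) : ℝ) ≤ W * c ∧
      ∀ E, E < W → ∀ j, E + W * j ∉ (Finset.range W).biUnion (fun E => (B E).image (fun j => E + W * j)) → j ∉ B E := by
  have _ := hW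
  constructor
  · calc ((((Finset.range W).biUnion (fun E => (B E).image (fun j => E + W * j))).card : ℕ) : ℝ)
        ≤ ((∑ E ∈ Finset.range W, ((B E).image (fun j => E + W * j)).card : ℕ) : ℝ) := by
          exact_mod_cast Finset.card_biUnion_le
      _ ≤ ∑ E ∈ Finset.range W, ((B E).card : ℝ) := by
          push_cast; exact Finset.sum_le_sum fun E _ => by exact_mod_cast Finset.card_image_le
      _ ≤ ∑ E ∈ Finset.range W, c := Finset.sum_le_sum fun E hE => hB E (Finset.mem_range.mp hE)
      _ = W * c := by rw [Finset.sum_const, Finset.card_range]; simp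
  · intro E hE j hv hj
    exact hv (Finset.mem_biUnion.mpr ⟨E, Finset.mem_range.mpr hE, Finset.mem_image.mpr ⟨j, hj, rfl⟩⟩)

end Literature.Computability.Cryptography.CubicClassSampling.LinnikStubs

end Part8

/-!
## Part 9 — port of `Summits/QuantumAdvantage/QuantumAdvantage/Theorems/LinnikCubicClassGroupsPureCubicClassGroupFBQPStubClassTableSemSlots.lean` (5 declarations kept)

# `LinnikCubicClassGroups.PureCubicClassGroupFBQP` () — stub `stub_classTableSem`, part SLOTS

Declarations of this Part (verbatim port; each keeps its own docstring and citation): `cubeRoots_length_le_three`, `gens_trueRoots_indep`, `mem_gens_trueRoots_iff`, `length_gens_trueRoots_le`, `slots_package`.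
-/

section Part9

namespace Literature.Computability.Cryptography.CubicClassSampling.LinnikStubs

open scoped _root_.NumberField nonZeroDivisors
open _root_.NumberField _root_.Polynomial
open Literature.NumberTheory.CubicFields
open Literature.NumberTheory.CubicFields.PureCubicCodes (Canon Mem)
open Literature.Computability.Cryptography
open Literature.Computability.Cryptography.CubicClassTable

/-- **At most three cube roots modulo a prime**: the list of `r < p` with `r³ ≡ c (mod p)` has length `≤ 3`.
[cite: BuchmannWilliams1988, §3 (semantics of the class-group table; supporting lemma)] -/
theorem cubeRoots_length_le_three {p : ℕ} (hp : p.Prime) (c : ℕ) :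
    ((List.range p).filter (fun r => r ^ 3 % p = c % p)).length ≤ 3 := by
  classical
  haveI : Fact p.Prime := ⟨hp⟩
  set l := (List.range p).filter (fun r => r ^ 3 % p = c % p) with hl
  have hnd : l.Nodup := List.Nodup.filter _ List.nodup_range
  set f : ℕ → ZMod p := fun r => (r : ZMod p) with hf
  set P : Polynomial (ZMod p) := X ^ 3 - C (c : ZMod p) with hP
  have hP0 : P ≠ 0 := X_pow_sub_C_ne_zero (by norm_num) _
  have hsub : l.toFinset.image f ⊆ P.roots.toFinset := by
    intro x hx
    rw [Finset.mem_image] at hx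
    obtain ⟨r, hr, rfl⟩ := hx
    rw [List.mem_toFinset, hl, List.mem_filter, List.mem_range, decide_eq_true_eq] at hr
    rw [Multiset.mem_toFinset, mem_roots hP0, IsRoot, hP, eval_sub, eval_pow, eval_X, eval_C, sub_eq_zero]
    have h : ((r ^ 3 : ℕ) : ZMod p) = (c : ZMod p) := (ZMod.natCast_eq_natCast_iff' _ _ _).2 hr.2
    push_cast at h; exact h
  have hinj : Set.InjOn f (l.toFinset : Set ℕ) := by
    intro r hr r' hr' h
    rw [Finset.mem_coe, List.mem_toFinset, hl, List.mem_filter, List.mem_range] at hr hr'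
    have h1 : (r : ZMod p).val = r := ZMod.val_cast_of_lt hr.1
    have h2 : (r' : ZMod p).val = r' := ZMod.val_cast_of_lt hr'.1
    have h3 := congrArg ZMod.val h
    rw [h1, h2] at h3; exact h3
  calc l.length = l.toFinset.card := (List.toFinset_card_of_nodup hnd).symm
    _ = (l.toFinset.image f).card := (Finset.card_image_of_injOn hinj).symm
    _ ≤ P.roots.toFinset.card := Finset.card_le_card hsub
    _ ≤ Multiset.card P.roots := Multiset.toFinset_card_le _
    _ ≤ P.natDegree := card_roots' P
    _ = 3 := by rw [hP, natDegree_X_pow_sub_C]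

section Slots

variable {K : Type} [Field K] [NumberField K] {a b : ℕ} {θ : K}
variable {F : WalkFns} {I : Inst} (ha : I.a = a) (hb : I.b = b) (hm : I.m = a * b ^ 2)
  (hps : ∀ p ∈ I.ps, p.Prime ∧ ¬ p ∣ 3 * I.m)
  (hord : Canon I.ord) (hordm : ∀ φ : K, Mem θ b I.ord φ ↔ IsIntegral ℤ φ)
  (hprime : PrimeSem F a b K θ I.ord)
  (hroots : ∀ x, F.roots x = (List.range x.1).filter (fun r => r ^ 3 % x.1 = x.2.1 % x.1))

include hroots in
/-- With the true roots the generator list does not depend on the position.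
[cite: BuchmannWilliams1988, §3 (semantics of the class-group table; supporting lemma)] -/
theorem gens_trueRoots_indep (v v' : ℕ) : F.gens I v = F.gens I v' := by
  unfold WalkFns.gens; simp_rw [hroots]

include hroots hm in
/-- The elements of the generator list with the true roots are the prime codes `primeL (p, r)`, `p = ps[i]`, `r` a cube root
of `ab²` modulo `p`. [cite: BuchmannWilliams1988, §3 (semantics of the class-group table; supporting lemma)] -/
theorem mem_gens_trueRoots_iff (v : ℕ) (c : ℕ × List ℤ) :
    c ∈ F.gens I v ↔ ∃ i < I.ps.length, ∃ r < I.ps.getD i 0,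
      r ^ 3 % I.ps.getD i 0 = (a * b ^ 2) % I.ps.getD i 0 ∧ c = F.primeL ((I.a, I.b), (I.ord, (I.ps.getD i 0, r))) := by
  unfold WalkFns.gens
  simp_rw [hroots, List.mem_flatMap, List.mem_range, List.mem_map, List.mem_filter, List.mem_range, decide_eq_true_eq, hm]
  constructor
  · rintro ⟨i, hi, r, ⟨hr, hr3⟩, rfl⟩; exact ⟨i, hi, r, hr, hr3, rfl⟩
  · rintro ⟨i, hi, r, hr, hr3, rfl⟩; exact ⟨i, hi, r, ⟨hr, hr3⟩, rfl⟩

include hroots hps in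
/-- The generator list with the true roots has at most `T = 3|ps|` elements.
[cite: BuchmannWilliams1988, §3 (semantics of the class-group table; supporting lemma)] -/
theorem length_gens_trueRoots_le (v : ℕ) : (F.gens I v).length ≤ 3 * I.ps.length := by
  unfold WalkFns.gens
  simp_rw [hroots]
  rw [List.length_flatMap]
  have h : ∀ i ∈ List.range I.ps.length, ((List.range (I.ps.getD i 0)).filter
      (fun r => r ^ 3 % I.ps.getD i 0 = I.m % I.ps.getD i 0) |>.map
        (fun rt => F.primeL ((I.a, I.b), (I.ord, (I.ps.getD i 0, rt))))).length ≤ 3 := by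
    intro i hi
    rw [List.mem_range] at hi
    rw [List.length_map]
    have hp : (I.ps.getD i 0).Prime := by
      rw [List.getD_eq_getElem _ _ hi]; exact (hps _ (List.getElem_mem hi)).1
    exact cubeRoots_length_le_three hp I.m
  calc (List.map (fun i => ((List.range (I.ps.getD i 0)).filter
        (fun r => r ^ 3 % I.ps.getD i 0 = I.m % I.ps.getD i 0) |>.map
          (fun rt => F.primeL ((I.a, I.b), (I.ord, (I.ps.getD i 0, rt))))).length) (List.range I.ps.length)).sum
      ≤ (List.map (fun _ => 3) (List.range I.ps.length)).sum := List.sum_le_sum (fun i hi => h i hi)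
    _ = 3 * I.ps.length := by simp [mul_comm]

include ha hb hm hps hord hordm hprime hroots in
/-- **The slot package.** There are integral ideals `𝔤_t` such that for every position `v` and every `t < 3|ps|` the slot
`gT v t` is the canonical code of `𝔤_t ≠ ⊥`; each `𝔤_t` is `𝓞_K` or a prime whose norm is in `ps`; every prime of norm
`p ∈ ps` is some `𝔤_t`; and the slots do not depend on `v`.
[cite: BuchmannWilliams1988, §3 (semantics of the class-group table; supporting lemma)] -/
theorem slots_package :
    ∃ 𝔤 : ℕ → Ideal (𝓞 K),
      (∀ v t, t < 3 * I.ps.length → 𝔤 t ≠ ⊥ ∧ Canon (F.gT I v t) ∧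
        ∀ φ : K, Mem θ I.b (F.gT I v t) φ ↔ φ ∈ ((𝔤 t : Ideal (𝓞 K)) : FractionalIdeal (𝓞 K)⁰ K)) ∧
      (∀ t, t < 3 * I.ps.length → 𝔤 t = ⊤ ∨ ((𝔤 t).IsPrime ∧ Ideal.absNorm (𝔤 t) ∈ I.ps)) ∧
      (∀ p ∈ I.ps, ∀ Q : Ideal (𝓞 K), Q.IsPrime → Ideal.absNorm Q = p → ∃ t, t < 3 * I.ps.length ∧ 𝔤 t = Q) ∧
      (∀ v v' t, F.gT I v t = F.gT I v' t) := by
  classical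
  have hgT : ∀ v v' t, F.gT I v t = F.gT I v' t := fun v v' t => by
    unfold WalkFns.gT; rw [gens_trueRoots_indep hroots v v']
  have hmemI : ∀ φ : K, Mem θ I.b I.ord φ ↔ φ ∈ ((⊤ : Ideal (𝓞 K)) : FractionalIdeal (𝓞 K)⁰ K) := fun φ => by
    rw [hb, hordm φ, FractionalIdeal.coeIdeal_top, mem_one_iff_isIntegral]
  -- every slot codes some nonzero integral ideal: a prime of norm in `ps`, or `⊤`
  have hslotP : ∀ t, ∃ P : Ideal (𝓞 K), P ≠ ⊥ ∧ Canon (F.gT I 0 t) ∧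
      (∀ φ : K, Mem θ I.b (F.gT I 0 t) φ ↔ φ ∈ (P : FractionalIdeal (𝓞 K)⁰ K)) ∧
      (P = ⊤ ∨ (P.IsPrime ∧ Ideal.absNorm P ∈ I.ps)) := by
    intro t
    by_cases ht : t < (F.gens I 0).length
    · have hmem : F.gT I 0 t ∈ F.gens I 0 := by
        unfold WalkFns.gT; rw [List.getD_eq_getElem _ _ ht]; exact List.getElem_mem ht
      obtain ⟨i, hi, r, hr, hr3, hc⟩ := (mem_gens_trueRoots_iff hm hroots 0 _).1 hmem
      have hpi : (I.ps.getD i 0) ∈ I.ps := by rw [List.getD_eq_getElem _ _ hi]; exact List.getElem_mem hi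
      obtain ⟨hp, hpd⟩ := hps _ hpi
      rw [hm, show 3 * (a * b ^ 2) = (3 * (a * b)) * b by ring] at hpd
      have hpd' : ¬ I.ps.getD i 0 ∣ 3 * (a * b) := fun h => hpd (dvd_mul_of_dvd_left h _)
      obtain ⟨hroot, -, -⟩ := hprime _ hp hpd'
      obtain ⟨hcan, P, hP0, hPp, hPn, hPm⟩ := hroot r hr hr3
      refine ⟨P, nonZeroDivisors.ne_zero hP0, by rw [hc, ha, hb]; exact hcan, fun φ => ?_, Or.inr ⟨hPp, by rw [hPn]; exact hpi⟩⟩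
      rw [hc, ha, hb, hPm φ, FractionalIdeal.mem_coeIdeal]
    · push Not at ht
      have hgt : F.gT I 0 t = I.ord := by unfold WalkFns.gT; rw [List.getD_eq_default _ _ ht]
      exact ⟨⊤, by simp, hgt ▸ hord, fun φ => by rw [hgt]; exact hmemI φ, Or.inl rfl⟩
  choose 𝔤 h𝔤0 h𝔤c h𝔤m h𝔤kind using hslotP
  refine ⟨𝔤, fun v t _ => ⟨h𝔤0 t, by rw [hgT v 0]; exact h𝔤c t, fun φ => by rw [hgT v 0]; exact h𝔤m t φ⟩,
    fun t _ => h𝔤kind t, fun p hp Q hQ hQn => ?_, hgT⟩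
  -- every prime of norm `p ∈ ps` occurs
  obtain ⟨i, hi, hpi⟩ := List.mem_iff_getElem.1 hp
  have hgetD : I.ps.getD i 0 = p := by rw [List.getD_eq_getElem _ _ hi, hpi]
  obtain ⟨hpr, hpd⟩ := hps p hp
  rw [hm, show 3 * (a * b ^ 2) = (3 * (a * b)) * b by ring] at hpd
  have hpd' : ¬ p ∣ 3 * (a * b) := fun h => hpd (dvd_mul_of_dvd_left h _)
  obtain ⟨-, -, hall⟩ := hprime p hpr hpd'
  obtain ⟨r, hr, hr3, hrQ⟩ := hall Q hQ hQn
  have hmem : F.primeL ((I.a, I.b), (I.ord, (I.ps.getD i 0, r))) ∈ F.gens I 0 :=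
    (mem_gens_trueRoots_iff hm hroots 0 _).2 ⟨i, hi, r, by rw [hgetD]; exact hr, by rw [hgetD]; exact hr3, rfl⟩
  obtain ⟨t, ht, htc⟩ := List.mem_iff_getElem.1 hmem
  have hgt : F.gT I 0 t = F.primeL ((a, b), (I.ord, (p, r))) := by
    unfold WalkFns.gT; rw [List.getD_eq_getElem _ _ ht, htc, ha, hb, hgetD]
  refine ⟨t, lt_of_lt_of_le ht (length_gens_trueRoots_le hps hroots 0), ?_⟩
  rw [← FractionalIdeal.coeIdeal_inj (K := K)]
  apply FractionalIdeal.ext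
  intro φ
  rw [← h𝔤m t φ, hgt, hb, hrQ φ, FractionalIdeal.mem_coeIdeal]

end Slots

end Literature.Computability.Cryptography.CubicClassSampling.LinnikStubs

end Part9

/-!
## Part 10 — port of `Summits/QuantumAdvantage/QuantumAdvantage/Theorems/LinnikCubicClassGroupsPureCubicClassGroupFBQPStubCubicGiantStepCycleRedSem.lean` (3 declarations kept)

# `LinnikCubicClassGroups.PureCubicClassGroupFBQP` () — stub `stub_cubicGiantStepCycle`, part RedSem

Declarations of this Part (verbatim port; each keeps its own docstring and citation): `redL_fst_spec`, `redL_snd_spec`, `redSem_of_specs`.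
-/

section Part10

namespace Literature.Computability.Cryptography.CubicClassSampling.LinnikStubs

open scoped _root_.NumberField nonZeroDivisors
open Literature.Computability.Cryptography
open Literature.Computability.Cryptography.CubicClassTable
open Literature.NumberTheory.CubicFields (PureCubicCodes.Mem PureCubicCodes.Canon PureCubicCodes.val norm_nonneg_iff)
open Literature.NumberTheory.NumberFields.PureCubic (real_embedding_val)

section RedSem

variable {K : Type*} [Field K] [NumberField K] {a b : ℕ} {θ : K} {σ₁ : K →+* ℝ} {σ₂ : K →+* ℂ}
  {lexE : (ℕ × ℕ) × (ℕ × List ℤ) → ℤ × ℤ × ℤ × ℕ}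
  {logE : (ℕ × ℕ) × ((ℤ × ℤ × ℤ × ℕ) × ℕ) → ℤ}
  {invE : (ℕ × ℕ) × (ℤ × ℤ × ℤ × ℕ) → ℤ × ℤ × ℤ × ℕ}
  {latScale : (ℕ × ℕ) × ((ℕ × List ℤ) × (ℤ × ℤ × ℤ × ℕ)) → ℕ × List ℤ}
  {redL : ((ℕ × ℕ) × ℕ) × (ℕ × List ℤ) → (ℕ × List ℤ) × ℤ}
  {isBigL : (ℕ × ℕ) × (ℕ × List ℤ) → Bool}

/-- **The first component of the reduction step**: under `LexMinSpec`, `InvSpec`, `ScaleSpec`, `RedLEq`, on the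
canonical code `c` of `J ≠ 0` with cylinder minimum `γ = val (lexE c)`, `(redL c).1` is canonical and codes
`{φ | φ γ ∈ J} = γ⁻¹ J`. [cite: BuchmannWilliams1988, §3 (semantics of the class-group table; supporting lemma)] -/
theorem redL_fst_spec (hlex : LexMinSpec a b K θ σ₁ σ₂ lexE) (hinv : InvSpec a b K θ invE)
    (hscale : ScaleSpec a b K θ latScale) (hred : RedLEq a b K θ lexE logE invE latScale redL)
    (prec : ℕ) {c : ℕ × List ℤ} (hc : PureCubicCodes.Canon c)
    {J : FractionalIdeal (𝓞 K)⁰ K} (hJ : J ≠ 0) (hcJ : ∀ φ : K, PureCubicCodes.Mem θ b c φ ↔ φ ∈ J) :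
    PureCubicCodes.Canon (redL (((a, b), prec), c)).1 ∧
      (∀ φ : K, PureCubicCodes.Mem θ b (redL (((a, b), prec), c)).1 φ ↔ φ * PureCubicCodes.val θ b (lexE ((a, b), c)) ∈ J) ∧
      (∀ φ : K, PureCubicCodes.Mem θ b (redL (((a, b), prec), c)).1 φ ↔
        φ ∈ FractionalIdeal.spanSingleton (𝓞 K)⁰ (PureCubicCodes.val θ b (lexE ((a, b), c)))⁻¹ * J) := by
  obtain ⟨hden, hmem, hpos, -, -⟩ := hlex c hc ⟨J, hJ, hcJ⟩
  set γ : K := PureCubicCodes.val θ b (lexE ((a, b), c)) with hγ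
  have hγ0 : γ ≠ 0 := fun h => by rw [h, map_zero] at hpos; exact lt_irrefl _ hpos
  obtain ⟨hden', hinv'⟩ := hinv (lexE ((a, b), c)) hden hγ0
  have hι0 : PureCubicCodes.val θ b (invE ((a, b), lexE ((a, b), c))) ≠ 0 := left_ne_zero_of_mul_eq_one hinv'
  have hιγ : PureCubicCodes.val θ b (invE ((a, b), lexE ((a, b), c))) = γ⁻¹ := eq_inv_of_mul_eq_one_left hinv'
  obtain ⟨h1, -⟩ := hred prec c hden hγ0
  obtain ⟨hcan, hmemS⟩ := hscale c (invE ((a, b), lexE ((a, b), c))) hc hden' hι0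
  have key : ∀ φ : K, PureCubicCodes.Mem θ b (redL (((a, b), prec), c)).1 φ ↔ φ * γ ∈ J := fun φ => by
    rw [h1, hmemS]
    constructor
    · rintro ⟨ψ, hψ, rfl⟩
      rw [hιγ, inv_mul_cancel_right₀ hγ0]
      exact (hcJ ψ).1 hψ
    · intro h
      exact ⟨φ * γ, (hcJ _).2 h, by rw [hιγ, mul_inv_cancel_right₀ hγ0]⟩
  refine ⟨h1 ▸ hcan, key, fun φ => ?_⟩
  rw [key, FractionalIdeal.mem_singleton_mul]
  constructor
  · intro h
    exact ⟨φ * γ, h, by rw [mul_comm φ γ, ← mul_assoc, inv_mul_cancel₀ hγ0, one_mul]⟩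
  · rintro ⟨y, hy, rfl⟩
    rwa [mul_comm γ⁻¹ y, inv_mul_cancel_right₀ hγ0]

/-- **The second component of the reduction step**: under `LexMinSpec`, `RedLEq`, `LogSpec` (and `θ³ = ab²`,
`ab` squarefree, so that the real conjugate of an element code is its value at the real cube roots), on the
canonical code `c` of `J ≠ 0` with cylinder minimum `γ`, `(redL c).2` is within `1` of `2^prec log σ₁ γ` whenever
`σ₁ γ ≥ 2^-prec`. [cite: BuchmannWilliams1988, §3 (semantics of the class-group table; supporting lemma)] -/
theorem redL_snd_spec (hab : Squarefree (a * b)) (hθ : θ ^ 3 = ((a * b ^ 2 : ℕ) : K))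
    (hlex : LexMinSpec a b K θ σ₁ σ₂ lexE) (hlog : LogSpec a b logE)
    (hred : RedLEq a b K θ lexE logE invE latScale redL)
    (prec : ℕ) {c : ℕ × List ℤ} (hc : PureCubicCodes.Canon c)
    {J : FractionalIdeal (𝓞 K)⁰ K} (hJ : J ≠ 0) (hcJ : ∀ φ : K, PureCubicCodes.Mem θ b c φ ↔ φ ∈ J)
    (hp : (1 : ℝ) / 2 ^ prec ≤ σ₁ (PureCubicCodes.val θ b (lexE ((a, b), c)))) :
    |((redL (((a, b), prec), c)).2 : ℝ) - 2 ^ prec * Real.log (σ₁ (PureCubicCodes.val θ b (lexE ((a, b), c))))| ≤ 1 := by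
  obtain ⟨hden, -, hpos, -, -⟩ := hlex c hc ⟨J, hJ, hcJ⟩
  have hγ0 : PureCubicCodes.val θ b (lexE ((a, b), c)) ≠ 0 := fun h => by
    rw [h, map_zero] at hpos; exact lt_irrefl _ hpos
  obtain ⟨-, h2⟩ := hred prec c hden hγ0
  rw [h2, real_embedding_val σ₁ hab hθ]
  rw [real_embedding_val σ₁ hab hθ] at hp
  exact hlog (lexE ((a, b), c)) prec hden hp

/-- **One reduction step, semantically** (the named Prop `CubicClassTable.RedSem` of
`Literature/Computability/Cryptography/CubicClassTableSpecs.lean`): for `θ³ = ab²` (`ab` squarefree) in a number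
field `K` with embeddings `σ₁` (real) and `σ₂`, the specifications `LexMinSpec` (G2), `LogSpec` (G3), `InvSpec`,
`ScaleSpec` (G1) and the operational equation `RedLEq` (P4) imply: on the canonical code of `J ≠ 0`, `redL` divides by
the cylinder minimum `γ` (the result codes `γ⁻¹ J`) and returns a `2^prec`-scaled logarithm of `σ₁ γ` certified to
`±1` whenever `σ₁ γ ≥ 2^-prec`. The other programs of the bundle (`roots, primeL, latProd, rhoS, starS, unitS`) are
arbitrary. [cite: BuchmannWilliams1988, §3 (semantics of the class-group table; supporting lemma)] -/
theorem redSem_of_specs : ∀ (a b : ℕ), Squarefree (a * b) →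
    ∀ (K : Type) [Field K] [NumberField K] (θ : K), θ ^ 3 = ((a * b ^ 2 : ℕ) : K) →
    ∀ (σ₁ : K →+* ℝ) (σ₂ : K →+* ℂ)
      (lexE : (ℕ × ℕ) × (ℕ × List ℤ) → ℤ × ℤ × ℤ × ℕ) (logE : (ℕ × ℕ) × ((ℤ × ℤ × ℤ × ℕ) × ℕ) → ℤ)
      (invE : (ℕ × ℕ) × (ℤ × ℤ × ℤ × ℕ) → ℤ × ℤ × ℤ × ℕ)
      (latScale : (ℕ × ℕ) × ((ℕ × List ℤ) × (ℤ × ℤ × ℤ × ℕ)) → ℕ × List ℤ)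
      (latProd : (ℕ × ℕ) × ((ℕ × List ℤ) × (ℕ × List ℤ)) → ℕ × List ℤ)
      (redL : ((ℕ × ℕ) × ℕ) × (ℕ × List ℤ) → (ℕ × List ℤ) × ℤ)
      (rhoS : ((ℕ × ℕ) × ℕ) × (ℕ × List ℤ) → (ℕ × List ℤ) × ℤ)
      (starS : ((ℕ × ℕ) × ℕ) × ((ℕ × List ℤ) × (ℕ × List ℤ)) → (ℕ × List ℤ) × ℤ)
      (unitS : (ℕ × ℕ) × ℕ → (ℕ × List ℤ) × ℤ)
      (roots : ℕ × ℕ × List Bool → List ℕ) (primeL : (ℕ × ℕ) × ((ℕ × List ℤ) × (ℕ × ℕ)) → ℕ × List ℤ),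
    CubicClassTable.LexMinSpec a b K θ σ₁ σ₂ lexE → CubicClassTable.LogSpec a b logE → CubicClassTable.InvSpec a b K θ invE → CubicClassTable.ScaleSpec a b K θ latScale →
    CubicClassTable.RedLEq a b K θ lexE logE invE latScale redL →
    CubicClassTable.RedSem ⟨roots, primeL, latProd, redL, rhoS, starS, unitS⟩ a b K θ σ₁ σ₂ := by
  intro a b hab K _ _ θ hθ σ₁ σ₂ lexE logE invE latScale latProd redL rhoS starS unitS roots primeL hlex hlog hinv hscale
    hred prec c J hJ hc hcJ
  obtain ⟨-, hmem, hpos, hcyl, hmin⟩ := hlex c hc ⟨J, hJ, hcJ⟩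
  obtain ⟨hcan, hmemR, -⟩ := redL_fst_spec hlex hinv hscale hred prec hc hJ hcJ
  exact ⟨PureCubicCodes.val θ b (lexE ((a, b), c)), (hcJ _).1 hmem, hpos, hcyl,
    fun φ hφ => hmin φ ((hcJ φ).2 hφ), hcan, hmemR,
    fun hp => redL_snd_spec hab hθ hlex hlog hred prec hc hJ hcJ hp⟩

end RedSem

end Literature.Computability.Cryptography.CubicClassSampling.LinnikStubs

end Part10

/-!
## Part 11 — port of `Summits/QuantumAdvantage/QuantumAdvantage/Theorems/LinnikCubicClassGroupsPureCubicClassGroupFBQPStubSemAffine.lean` (1 declarations kept)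

# `LinnikCubicClassGroups.PureCubicClassGroupFBQP` () — stub `stub_semAffine`

Declarations of this Part (verbatim port; each keeps its own docstring and citation): `stub_semAffine`.
-/

section Part11

namespace Literature.Computability.Cryptography.CubicClassSampling.LinnikStubs

/-- **`stub_semAffine`**: for `Y_E` affine modulo `R` along the classes (`Y_E' − Y_E + R Σ μ_t Δd_t ∈ Rℤ`), the shifts
`y_E = 2^s fract(Y_E/R) ∈ [0, 2^s)` satisfy `y_E R/2^s ≡ Y_E (mod R)`, their floors `σ_E = ⌊y_E⌋ < 2^s` are within `1`, and
`y_E' − y_E + 2^s Σ μ_t Δd_t ∈ 2^s ℤ`. [cite: BuchmannWilliams1988, §3 (semantics of the class-group table; supporting lemma)] -/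
theorem stub_semAffine :
    ∀ (R : ℝ), 0 < R → ∀ (s T : ℕ) (Y : ℕ → ℝ) (μ : Fin T → ℝ) (d : ℕ → Fin T → ℝ) (cls : ℕ → ℕ),
      (∀ E E', cls E = cls E' → ∃ z : ℤ, Y E' - Y E + R * ∑ t, μ t * (d E' t - d E t) = z * R) →
      (∀ E, 0 ≤ (2 : ℝ) ^ s * Int.fract (Y E / R) ∧ (2 : ℝ) ^ s * Int.fract (Y E / R) < (2 : ℝ) ^ s) ∧
      (∀ E, (⌊(2 : ℝ) ^ s * Int.fract (Y E / R)⌋₊ : ℝ) ≤ (2 : ℝ) ^ s * Int.fract (Y E / R) ∧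
        (2 : ℝ) ^ s * Int.fract (Y E / R) < (⌊(2 : ℝ) ^ s * Int.fract (Y E / R)⌋₊ : ℝ) + 1) ∧
      (∀ E, ⌊(2 : ℝ) ^ s * Int.fract (Y E / R)⌋₊ < 2 ^ s) ∧
      (∀ E, ∃ q : ℤ, (2 : ℝ) ^ s * Int.fract (Y E / R) * (R / ((2 ^ s : ℕ) : ℝ)) = Y E + q * R) ∧
      (∀ E E', cls E = cls E' → ∃ z : ℤ, (2 : ℝ) ^ s * Int.fract (Y E' / R) - (2 : ℝ) ^ s * Int.fract (Y E / R) +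
        (2 : ℝ) ^ s * ∑ t, μ t * (d E' t - d E t) = (2 : ℝ) ^ s * z) := by
  intro R hR s T Y μ d cls haff
  have h2s : (0 : ℝ) < (2 : ℝ) ^ s := by positivity
  have hRne : R ≠ 0 := hR.ne'
  have hy0 : ∀ E, 0 ≤ (2 : ℝ) ^ s * Int.fract (Y E / R) := fun E =>
    mul_nonneg h2s.le (Int.fract_nonneg _)
  have hy1 : ∀ E, (2 : ℝ) ^ s * Int.fract (Y E / R) < (2 : ℝ) ^ s := fun E => by
    calc (2 : ℝ) ^ s * Int.fract (Y E / R) < (2 : ℝ) ^ s * 1 := by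
          gcongr
          exact Int.fract_lt_one _
      _ = (2 : ℝ) ^ s := mul_one _
  refine ⟨fun E => ⟨hy0 E, hy1 E⟩, fun E => ⟨Nat.floor_le (hy0 E), Nat.lt_floor_add_one _⟩,
    fun E => ?_, fun E => ?_, fun E E' hEE' => ?_⟩
  · rw [Nat.floor_lt (hy0 E)]
    push_cast
    exact hy1 E
  · refine ⟨-⌊Y E / R⌋, ?_⟩
    unfold Int.fract
    push_cast
    field_simp
    ring
  · obtain ⟨z, hz⟩ := haff E E' hEE'
    refine ⟨z - ⌊Y E' / R⌋ + ⌊Y E / R⌋, ?_⟩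
    have hsum : ∑ t, μ t * (d E' t - d E t) = z - (Y E' - Y E) / R := by
      rw [eq_sub_iff_add_eq, add_div' _ _ _ hRne, div_eq_iff hRne]
      linarith [hz]
    rw [hsum]
    unfold Int.fract
    push_cast
    field_simp
    ring

end Literature.Computability.Cryptography.CubicClassSampling.LinnikStubs

end Part11

/-!
## Part 12 — port of `Summits/QuantumAdvantage/QuantumAdvantage/Theorems/LinnikCubicClassGroupsPureCubicClassGroupFBQP.lean` (2 declarations kept)

# `LinnikCubicClassGroups.PureCubicClassGroupFBQP` () — PROVED (the table semantics `stub_semMain` and the )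

Declarations of this Part (verbatim port; each keeps its own docstring and citation): `stub_semMain`, `claimTableSem_holds`.
-/

section Part12

namespace Literature.Computability.Cryptography.CubicClassSampling.LinnikStubs

open scoped _root_.NumberField nonZeroDivisors
open _root_.NumberField
open Literature.NumberTheory.CubicFields
open Literature.NumberTheory.CubicFields.PureCubicCodes (Canon Mem)
open Literature.NumberTheory.NumberFields.PureCubic (abs_discr_le ne_zero_of_squarefree_mul)
open Literature.Computability.Cryptography
open Literature.Computability.Cryptography.CubicClassTable
open Literature.Computability.Cryptography.CubicClassTable.WalkFns
open Literature.Computability.Cryptography.CubicClassSampling (ClaimTableSem ShiftCellCosetTable ClassTableInterfaceQ3)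

set_option maxHeartbeats 800000 in
/-- **`stub_semMain`**: the table semantics
`ClaimTableSem` from the coordinate lemma, the drift lemma, the affine-shift lemma and the landed packages (module docstring;
the composition is long, hence the heartbeat budget).
[cite: BuchmannWilliams1988, §3 (semantics of the class-group table; supporting lemma)] -/
theorem stub_semMain :
    (∀ (G : ℤ → ℝ), StrictMono G → ∀ (n₀ : ℕ), 0 < n₀ → ∀ (R : ℝ), (∀ i, G (i + n₀) = G i + R) →
      ∀ (idx : ℝ → ℤ), (∀ x, G (idx x) ≤ x ∧ x < G (idx x + 1)) →
      ∀ (Lab : ℤ → ℕ × List ℤ), (∀ i j, Lab i = Lab j ↔ (n₀ : ℤ) ∣ i - j) →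
      ∀ (npp s : ℕ) (η ηd : ℝ), 0 ≤ η → 0 ≤ ηd →
      ∀ (σ j : ℕ) (u : ℝ),
        (σ : ℝ) * (R / ((2 ^ s : ℕ) : ℝ)) + (j : ℝ) * (R / ((2 ^ s : ℕ) : ℝ)) - ηd < u →
        u < (σ : ℝ) * (R / ((2 ^ s : ℕ) : ℝ)) + (j : ℝ) * (R / ((2 ^ s : ℕ) : ℝ)) + R / ((2 ^ s : ℕ) : ℝ) + ηd →
        (∀ (k : ℤ) (m : ℕ), (m : ℝ) / (2 : ℝ) ^ npp < G (k + 1) - G k →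
          ¬ ((σ : ℝ) * (R / ((2 ^ s : ℕ) : ℝ)) + (j : ℝ) * (R / ((2 ^ s : ℕ) : ℝ)) - (η + ηd) ≤ G k + m / (2 : ℝ) ^ npp ∧
              G k + m / (2 : ℝ) ^ npp ≤
                (σ : ℝ) * (R / ((2 ^ s : ℕ) : ℝ)) + (j : ℝ) * (R / ((2 ^ s : ℕ) : ℝ)) + R / ((2 ^ s : ℕ) : ℝ) + (η + ηd))) →
        (∀ (k : ℤ) (m : ℕ), (m : ℝ) / (2 : ℝ) ^ npp < G (k + 1) - G k → η < |u - (G k + m / (2 : ℝ) ^ npp)|) ∧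
        (Lab (idx u), ⌊(u - G (idx u)) * (2 : ℝ) ^ npp⌋₊) =
          (Lab (idx ((((σ + j) % 2 ^ s : ℕ) : ℝ) * (R / ((2 ^ s : ℕ) : ℝ)))),
            ⌊(((((σ + j) % 2 ^ s : ℕ) : ℝ) * (R / ((2 ^ s : ℕ) : ℝ))) -
              G (idx ((((σ + j) % 2 ^ s : ℕ) : ℝ) * (R / ((2 ^ s : ℕ) : ℝ))))) * (2 : ℝ) ^ npp⌋₊)) →
    (∀ (prec k s r : ℕ) (R main BN : ℝ) (j' : ℕ) (N tstar : ℤ), 0 < r → k + s ≤ prec → j' < 2 ^ s →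
        |(r : ℝ) - 2 ^ k * R| ≤ 1 →
        tstar = ((j' * r * 2 ^ (prec - k - s) : ℕ) : ℤ) + N * ((r * 2 ^ (prec - k) : ℕ) : ℤ) →
        |(N : ℝ) - 2 ^ prec * main / ((r * 2 ^ (prec - k) : ℕ) : ℝ)| ≤ BN →
        |(tstar : ℝ) / 2 ^ prec -
            ((j' : ℝ) * (R / ((2 ^ s : ℕ) : ℝ)) + (N : ℝ) * R + ((r : ℝ) / 2 ^ k - R) / ((r : ℝ) / 2 ^ k) * main)| ≤
          (BN + 1) / 2 ^ k) →
    (∀ (R : ℝ), 0 < R → ∀ (s T : ℕ) (Y : ℕ → ℝ) (μ : Fin T → ℝ) (d : ℕ → Fin T → ℝ) (cls : ℕ → ℕ),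
        (∀ E E', cls E = cls E' → ∃ z : ℤ, Y E' - Y E + R * ∑ t, μ t * (d E' t - d E t) = z * R) →
        (∀ E, 0 ≤ (2 : ℝ) ^ s * Int.fract (Y E / R) ∧ (2 : ℝ) ^ s * Int.fract (Y E / R) < (2 : ℝ) ^ s) ∧
        (∀ E, (⌊(2 : ℝ) ^ s * Int.fract (Y E / R)⌋₊ : ℝ) ≤ (2 : ℝ) ^ s * Int.fract (Y E / R) ∧
          (2 : ℝ) ^ s * Int.fract (Y E / R) < (⌊(2 : ℝ) ^ s * Int.fract (Y E / R)⌋₊ : ℝ) + 1) ∧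
        (∀ E, ⌊(2 : ℝ) ^ s * Int.fract (Y E / R)⌋₊ < 2 ^ s) ∧
        (∀ E, ∃ q : ℤ, (2 : ℝ) ^ s * Int.fract (Y E / R) * (R / ((2 ^ s : ℕ) : ℝ)) = Y E + q * R) ∧
        (∀ E E', cls E = cls E' → ∃ z : ℤ, (2 : ℝ) ^ s * Int.fract (Y E' / R) - (2 : ℝ) ^ s * Int.fract (Y E / R) +
          (2 : ℝ) ^ s * ∑ t, μ t * (d E' t - d E t) = (2 : ℝ) ^ s * z)) →
    ClaimTableSem := by
  intro _hCoords _hDrift hAffine Fw lexE logE invE latScale a b hab hab1 K _ _ hdeg θ hθ σ₁ σ₂ hσ₂ ord hord hordm hlex hlog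
    hinv hscale hredL hprod hprime hroots m ps r k hps hm hr ℓe npp ℓy ℓκ ℓb prec s s₀ Tdbl Bfin Bb margin cap e _h20 hk hkprec
    hs hsy hs₀ hTdbl hmargin hBb hcap hcapp hℓb hℓκ
  classical
  -- ### the instance, the coin-free bundle, basic numerics
  obtain ⟨ha, hb⟩ := ne_zero_of_squarefree_mul hab
  set I : Inst := ⟨a, b, m, ps, ord, r, k, prec, s, ℓe, npp, ℓy, ℓκ, ℓb, s₀, Tdbl, Bfin, Bb, margin⟩ with hI
  set rts : ℕ × ℕ × List Bool → List ℕ := fun x => (List.range x.1).filter (fun r => r ^ 3 % x.1 = x.2.1 % x.1) with hrts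
  set F' : WalkFns := { Fw with roots := rts } with hF'
  have hsz : I.ps.length < 2 ^ Nat.size ps.length := Nat.lt_size_self _
  obtain ⟨hprec, h9, hk4, hks, hnpp⟩ := inst_numerics (ℓe := ℓe) (s := s) (npp := npp) (e := e) (k := k) (prec := prec)
    (sz := Nat.size ps.length) ha hb hk hkprec
  have hLD' : Nat.size (a * b) ≤ Nat.size (27 * a ^ 2 * b ^ 2) := size_ab_le ha hb
  have hred' : RedSem F' a b K θ σ₁ σ₂ :=
    redSem_of_specs a b hab K θ hθ σ₁ σ₂ lexE logE invE latScale Fw.latProd Fw.redL Fw.rhoS Fw.starS Fw.unitS rts Fw.primeL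
      hlex hlog hinv hscale hredL
  have hprod' : ProdSpec I.a I.b K θ F'.latProd := hprod
  have hcap' : (243 * I.a ^ 2 * I.b ^ 2) ^ 2 ≤ cap := hcap
  have hps' : ∀ p ∈ I.ps, p.Prime ∧ ¬ p ∣ 3 * I.m := hps
  have hd1 : (1 : ℝ) ≤ |(discr K : ℝ)| := by
    rw [← Int.cast_abs]; exact_mod_cast Int.one_le_abs (discr_ne_zero K)
  have hd2 : (2 : ℝ) ≤ |(discr K : ℝ)| := by
    have h := abs_discr_gt_two (K := K) (by rw [hdeg]; norm_num)
    rw [← Int.cast_abs]; exact_mod_cast h.le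
  have hd27 : |(discr K : ℝ)| ≤ 27 * (a : ℝ) ^ 2 * (b : ℝ) ^ 2 := by
    have h := abs_discr_le hdeg hab hab1 hθ
    rw [← Int.cast_abs]; exact_mod_cast h
  obtain ⟨hLBKN, -, hdLD, hd0⟩ := walk_consts (I := I) hdeg hab hab1 hθ hprec
  obtain ⟨hLB0, -⟩ := logB_bounds (K := K)
  have hLBd6 : Real.log (3 * Real.sqrt |(discr K : ℝ)|) ≤ |(discr K : ℝ)| ^ 6 := logB_le_pow_six hd2
  have hRd6 : Units.regulator K ≤ |(discr K : ℝ)| ^ 6 := regulator_le_abs_discr_pow_six K hdeg σ₁ σ₂ hσ₂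
  -- ### the slots and their cylinder minima
  obtain ⟨𝔤, hslot', hkind, hall, hgT⟩ := slots_package (K := K) (θ := θ) (F := F') (I := I) rfl rfl hm hps' hord hordm
    hprime (fun x => rfl)
  have h𝔤 : ∀ t, t < 3 * ps.length → 𝔤 t ≠ ⊥ := fun t ht => (hslot' 0 t ht).1
  have hγex : ∀ t, ∃ γ : K, t < I.T → γ ∈ (𝔤 t : FractionalIdeal (𝓞 K)⁰ K) ∧ 0 < σ₁ γ ∧ ‖σ₂ γ‖ < 1 ∧
      (∀ φ : K, φ ∈ (𝔤 t : FractionalIdeal (𝓞 K)⁰ K) → 0 < σ₁ φ → ‖σ₂ φ‖ < 1 → σ₁ γ ≤ σ₁ φ) := by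
    intro t
    by_cases ht : t < I.T
    · obtain ⟨h0, hc, hmem⟩ := hslot' 0 t ht
      obtain ⟨γ, hγJ, hγpos, hγcyl, hγmin, -⟩ := hred' prec (F'.gT I 0 t) (𝔤 t : FractionalIdeal (𝓞 K)⁰ K)
        (FractionalIdeal.coeIdeal_ne_zero.mpr h0) hc hmem
      exact ⟨γ, fun _ => ⟨hγJ, hγpos, hγcyl, hγmin⟩⟩
    · exact ⟨1, fun h => absurd h ht⟩
  choose γ hγ using hγex
  have hslot : ∀ v, ∀ t < I.T, 𝔤 t ≠ ⊥ ∧ Canon (F'.gT I v t) ∧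
      (∀ φ : K, Mem θ I.b (F'.gT I v t) φ ↔ φ ∈ (𝔤 t : FractionalIdeal (𝓞 K)⁰ K)) ∧
      γ t ∈ (𝔤 t : FractionalIdeal (𝓞 K)⁰ K) ∧ 0 < σ₁ (γ t) ∧ ‖σ₂ (γ t)‖ < 1 ∧
      (∀ φ : K, φ ∈ (𝔤 t : FractionalIdeal (𝓞 K)⁰ K) → 0 < σ₁ φ → ‖σ₂ φ‖ < 1 → σ₁ (γ t) ≤ σ₁ φ) := by
    intro v t ht
    obtain ⟨h0, hc, hmem⟩ := hslot' v t ht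
    exact ⟨h0, hc, hmem, hγ t ht⟩
  -- ### the regulator unit, the six-gap, `R ≥ log 2 / 6`
  obtain ⟨-, n₁, -, -, ε, hn₁, -, hn₁R, hε, hreg, -⟩ :=
    circle_packageB (σ₁ := σ₁) hdeg hσ₂ hab hab1 hθ (1 : FractionalIdeal (𝓞 K)⁰ K) one_ne_zero
  have h6 : ∀ A : FractionalIdeal (𝓞 K)⁰ K, A ≠ 0 → ∀ x₀ ∈ posRelMinima σ₁ σ₂ A, ∀ i : ℤ,
      2 * σ₁ (voronoiChain σ₁ σ₂ A x₀ i) ≤ σ₁ (voronoiChain σ₁ σ₂ A x₀ (i + 6)) :=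
    fun A _ x₀ hx₀ i => voronoiChain_six_gap hdeg hσ₂ ε hε stub_packing hx₀ i
  have hR6 : Real.log 2 / 6 ≤ Units.regulator K := regulator_ge_of_period hn₁ hn₁R
  have hR16 : (1 : ℝ) / 16 ≤ Units.regulator K := regulator_sixteenth_le hR6
  have hRpos : 0 < Units.regulator K := lt_of_lt_of_le (by norm_num) hR16
  set R : ℝ := Units.regulator K with hRdef
  -- ### the classes
  obtain ⟨Λ, hfin, cls, Ag, α, lam, hΛidx, hcls, hAg0, hAα, hlam, hinj⟩ :=
    classes_package hdeg hσ₂ hε hreg (3 * ps.length) (2 ^ ℓe) 𝔤 h𝔤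
  -- ### the class circles
  have hcirc := fun g => circle_packageB (σ₁ := σ₁) hdeg hσ₂ hab hab1 hθ (Ag g) (hAg0 g)
  choose x₀ n₀ idx Lab εg hn₀ hx₀ hn₀R _hεg _hregg _hperK hmono hper hgap hposc hidx hLab hLabper _hone _h6g using hcirc
  -- ### the cell functions, the shifts, the slopes
  set S2 : ℝ := ((2 ^ s : ℕ) : ℝ) with hS2
  have hS2pos : 0 < S2 := by rw [hS2]; positivity
  have hS2e : S2 = (2 : ℝ) ^ s := by rw [hS2]; push_cast; ring
  set C : ℕ → ℕ → (ℕ × List ℤ) × ℕ := fun g i =>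
    (Lab g (idx g ((i : ℝ) * (R / S2))),
      ⌊(((i : ℝ) * (R / S2)) - Real.log (σ₁ (voronoiChain σ₁ σ₂ (Ag g) (x₀ g) (idx g ((i : ℝ) * (R / S2)))))) *
        (2 : ℝ) ^ npp⌋₊) with hC
  set cδ : ℝ := ((r : ℝ) / 2 ^ k - R) / ((r : ℝ) / 2 ^ k) with hcδ
  set dg : ℕ → Fin (3 * ps.length) → ℝ := fun E t => ((E / (2 ^ ℓe) ^ (t : ℕ) % 2 ^ ℓe : ℕ) : ℝ) with hdg
  set Y : ℕ → ℝ := fun E => -Real.log (σ₁ (α E)) + cδ * ∑ t : Fin (3 * ps.length), dg E t * Real.log (σ₁ (γ t)) with hY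
  set μ : Fin (3 * ps.length) → ℝ := fun t => (lam t - cδ * Real.log (σ₁ (γ t))) / R with hμ
  set y : ℕ → ℝ := fun E => (2 : ℝ) ^ s * Int.fract (Y E / R) with hy
  set σf : ℕ → ℕ := fun E => ⌊y E⌋₊ with hσf
  -- the affine package
  have hYaff : ∀ E E', cls E = cls E' → ∃ z : ℤ, Y E' - Y E + R * ∑ t, μ t * (dg E' t - dg E t) = z * R := by
    intro E E' hEE'
    obtain ⟨z, hz⟩ := hlam E E' hEE'
    refine ⟨-z, ?_⟩
    have hsum : R * ∑ t, μ t * (dg E' t - dg E t) =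
        ∑ t, lam t * (dg E' t - dg E t) - cδ * ∑ t, (dg E' t - dg E t) * Real.log (σ₁ (γ t)) := by
      rw [Finset.mul_sum, Finset.mul_sum, ← Finset.sum_sub_distrib]
      refine Finset.sum_congr rfl fun t _ => ?_
      rw [hμ]; field_simp
    have hYd : Y E' - Y E = -(Real.log (σ₁ (α E')) - Real.log (σ₁ (α E))) +
        cδ * ∑ t, (dg E' t - dg E t) * Real.log (σ₁ (γ t)) := by
      rw [hY]; simp only
      rw [show ∑ t, (dg E' t - dg E t) * Real.log (σ₁ (γ t)) =
          ∑ t, dg E' t * Real.log (σ₁ (γ t)) - ∑ t, dg E t * Real.log (σ₁ (γ t)) by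
        rw [← Finset.sum_sub_distrib]; exact Finset.sum_congr rfl fun t _ => by ring]
      ring
    have hz' : Real.log (σ₁ (α E')) - Real.log (σ₁ (α E)) - ∑ t, lam t * (dg E' t - dg E t) = z * R := by
      rw [hdg]; exact hz
    rw [hsum, hYd]; push_cast; linarith
  obtain ⟨hy01, hyfloor, hσlt, hycong, hyaff⟩ := hAffine R hRpos s (3 * ps.length) Y μ dg cls hYaff
  -- ### the coin clause
  set W : ℕ := (2 ^ ℓe) ^ (3 * ps.length) with hW
  have hWI : I.W = W := rfl
  have hW0 : 0 < W := by rw [hW]; positivity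
  have hpcap : ∀ p ∈ I.ps, p ≤ cap := fun p hp => prime_le_cap ha hb (hcapp p hp)
  obtain ⟨Badκ, hBadcard, hBadoff⟩ : ∃ Badκ : Finset ℕ, ((Badκ.card : ℝ) ≤ (1 / 2) ^ (40 + e) * 2 ^ ℓκ) ∧
      ∀ v : ℕ, (v / (W * 2 ^ ℓy)) % 2 ^ ℓκ ∉ Badκ →
        Fw.classTableOpQ I cap v = F'.classTableOpQ I cap (v % (W * 2 ^ ℓy)) :=
    ⟨_, coins_clause Fw I cap e hroots hps' hpcap hℓb hℓκ⟩
  -- ### the defect sets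
  set η₀ : ℝ := R / 2 ^ (s + 3) + R / 2 ^ (s + 3) with hη₀
  set B : ℕ → Finset ℕ := fun E => (Finset.range (2 ^ ℓy)).filter (fun j : ℕ => ∃ (k : ℤ) (m : ℕ),
      (m : ℝ) / (2 : ℝ) ^ npp < Real.log (σ₁ (voronoiChain σ₁ σ₂ (Ag (cls E)) (x₀ (cls E)) (k + 1))) -
        Real.log (σ₁ (voronoiChain σ₁ σ₂ (Ag (cls E)) (x₀ (cls E)) k)) ∧
      (σf E : ℝ) * (R / S2) + (j : ℝ) * (R / S2) - η₀ ≤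
        Real.log (σ₁ (voronoiChain σ₁ σ₂ (Ag (cls E)) (x₀ (cls E)) k)) + m / (2 : ℝ) ^ npp ∧
      Real.log (σ₁ (voronoiChain σ₁ σ₂ (Ag (cls E)) (x₀ (cls E)) k)) + m / (2 : ℝ) ^ npp ≤
        (σf E : ℝ) * (R / S2) + (j : ℝ) * (R / S2) + R / S2 + η₀) with hB
  set D : Finset ℕ := (Finset.range W).biUnion (fun E => (B E).image (fun j => E + W * j)) with hD
  -- per-block defect count
  have hBcard : ∀ E, E < W → ((B E).card : ℝ) ≤ (1 / 2) ^ (30 + e) * 2 ^ ℓy := by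
    intro E _
    set g := cls E with hg
    have hGm : StrictMono (fun i => Real.log (σ₁ (voronoiChain σ₁ σ₂ (Ag g) (x₀ g) i))) := hmono g
    have hΔ : 0 < R / S2 := div_pos hRpos hS2pos
    have h2η : 2 * η₀ < R / S2 := by
      rw [hη₀, hS2e, pow_add]
      have h8 : (0 : ℝ) < 2 ^ s := by positivity
      rw [show R / (2 ^ s * 2 ^ 3) = (R / 2 ^ s) / 8 by ring]
      have : 0 < R / 2 ^ s := div_pos hRpos h8
      linarith
    have hq : (2 ^ ℓy : ℕ) * (R / S2) + R / S2 + 2 * η₀ ≤ ((2 ^ (ℓy - s) + 1 : ℕ) : ℝ) * R := by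
      have e1 : ((2 ^ ℓy : ℕ) : ℝ) * (R / S2) = ((2 ^ (ℓy - s) : ℕ) : ℝ) * R := by
        rw [hS2e]; push_cast
        rw [show (2 : ℝ) ^ ℓy = 2 ^ (ℓy - s) * 2 ^ s by rw [← pow_add]; congr 1; omega]
        field_simp
      rw [e1]; push_cast
      have h1 : R / S2 + 2 * η₀ ≤ R := by
        rw [hη₀, hS2e]
        have hs1 : (2 : ℝ) ≤ 2 ^ s ∨ s = 0 := by
          rcases Nat.eq_zero_or_pos s with h | h
          · exact Or.inr h
          · exact Or.inl (by calc (2:ℝ) = 2 ^ 1 := by norm_num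
                                 _ ≤ 2 ^ s := pow_le_pow_right₀ (by norm_num) h)
        have h8 : R / 2 ^ (s + 3) = R / 2 ^ s / 8 := by rw [pow_add]; ring
        rw [h8]
        have hRs : R / 2 ^ s ≤ R := div_le_self hRpos.le (one_le_pow₀ (by norm_num))
        rcases hs1 with h2 | h0
        · have : R / 2 ^ s ≤ R / 2 := div_le_div_of_nonneg_left hRpos.le (by norm_num) h2
          linarith
        · subst h0; simp at hRs ⊢; linarith
      linarith
    have hNpos : (0 : ℝ) < (2 : ℝ) ^ npp := by positivity
    have h := ap_defect_card_le hGm (hn₀ g) (hper g) (hidx g) hNpos ((σf E : ℝ) * (R / S2)) hΔ h2η (2 ^ ℓy)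
      (2 ^ (ℓy - s) + 1) hq (hgap g)
    have h2 := num_defect_card (npp := npp) (e := e) hRpos.le hRd6 hLBd6 (period_le_nine_pow_six (hn₀R g) hRd6 hd1) hd1 hdLD
      (by change npp + 6 * Nat.size (27 * a ^ 2 * b ^ 2) + 36 + e ≤ s; omega) hsy
    push_cast at h h2 ⊢
    exact h.trans h2
  obtain ⟨hDcard, hDoff⟩ := defects_biUnion hW0 B hBcard
  -- ### the witnesses
  refine ⟨Λ, hfin, fun u => F'.classTableOpQ I cap u, cls, σf, C, y, μ, Badκ, D, ?_, ?_⟩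
  · -- the index of the hidden lattice
    rw [hΛidx, closure_slots_eq 𝔤 h𝔤 ps hkind hall]
  refine ⟨hBadcard, fun v hv => hBadoff v hv, ?_, ?_, ?_, ?_, ?_, ?_, ?_⟩
  · -- (iii) the defect density
    calc ((D.card : ℕ) : ℝ) ≤ W * ((1 / 2) ^ (30 + e) * 2 ^ ℓy) := hDcard
      _ = (1 / 2) ^ (30 + e) * ((W * 2 ^ ℓy : ℕ) : ℝ) := by push_cast; ring
  · -- (iii) the shift-cell identity off the defects
    intro E hE j hj hEj
    have hjB : j ∉ B E := hDoff E hE j hEj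
    have hgood : ∀ (k' : ℤ) (m' : ℕ), (m' : ℝ) / (2 : ℝ) ^ npp <
        Real.log (σ₁ (voronoiChain σ₁ σ₂ (Ag (cls E)) (x₀ (cls E)) (k' + 1))) -
          Real.log (σ₁ (voronoiChain σ₁ σ₂ (Ag (cls E)) (x₀ (cls E)) k')) →
        ¬ ((σf E : ℝ) * (R / S2) + (j : ℝ) * (R / S2) - η₀ ≤
            Real.log (σ₁ (voronoiChain σ₁ σ₂ (Ag (cls E)) (x₀ (cls E)) k')) + m' / (2 : ℝ) ^ npp ∧
          Real.log (σ₁ (voronoiChain σ₁ σ₂ (Ag (cls E)) (x₀ (cls E)) k')) + m' / (2 : ℝ) ^ npp ≤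
            (σf E : ℝ) * (R / S2) + (j : ℝ) * (R / S2) + R / S2 + η₀) := by
      intro k' m' hm' hcon
      exact hjB (Finset.mem_filter.mpr ⟨Finset.mem_range.mpr hj, k', m', hm', hcon⟩)
    have hyE : ∃ q : ℤ, y E * (R / S2) = (-Real.log (σ₁ (α E)) + cδ *
        ∑ t ∈ Finset.range I.T, ((E / (2 ^ I.ℓe) ^ t % 2 ^ I.ℓe : ℕ) : ℝ) * Real.log (σ₁ (γ t))) + q * R := by
      obtain ⟨q, hq⟩ := hycong E
      refine ⟨q, ?_⟩
      rw [← hS2] at hq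
      rw [hq, hY]
      simp only [hdg]
      rw [← Fin.sum_univ_eq_sum_range (fun t => ((E / (2 ^ I.ℓe) ^ t % 2 ^ I.ℓe : ℕ) : ℝ) * Real.log (σ₁ (γ t)))]
      rfl
    have hmain := table_value_eq_shiftCell (F := F') (I := I) hdeg hσ₂ ε hε hreg hab hab1 hθ hred' hprod' hcap' hord hordm h6
      hR6 hs₀ hTdbl hBb hmargin hr hsz hk hkprec hs hslot (hWI ▸ hE) hj (hAα E).1 (hAα E).2
      (hx₀ (cls E)) (hn₀ (cls E)) (hper (cls E)) (hidx (cls E)) (hLab (cls E)) (hLabper (cls E)) (hyfloor E) hyE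
      (by rw [← hS2, ← hη₀]; exact hgood)
    rw [← hS2] at hmain
    change F'.classTableOpQ I cap (E + I.W * j) = C (cls E) ((σf E + j) % 2 ^ s)
    rw [hmain]
  · -- (iv) classes are cosets
    intro E _ E' _
    exact hcls E E'
  · -- (iv) cells of distinct classes are distinct
    intro E _ E' _ i _ i' _ hCC
    have hL : Lab (cls E) (idx (cls E) ((i : ℝ) * (R / S2))) = Lab (cls E') (idx (cls E') ((i' : ℝ) * (R / S2))) :=
      (Prod.mk.inj hCC).1
    set x := voronoiChain σ₁ σ₂ (Ag (cls E)) (x₀ (cls E)) (idx (cls E) ((i : ℝ) * (R / S2))) with hx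
    set x' := voronoiChain σ₁ σ₂ (Ag (cls E')) (x₀ (cls E')) (idx (cls E') ((i' : ℝ) * (R / S2))) with hx'
    have hx0 : x ≠ 0 := (map_ne_zero σ₁).mp (hposc (cls E) _).ne'
    have hx'0 : x' ≠ 0 := (map_ne_zero σ₁).mp (hposc (cls E') _).ne'
    have hIJ : FractionalIdeal.spanSingleton (𝓞 K)⁰ x⁻¹ * Ag (cls E) =
        FractionalIdeal.spanSingleton (𝓞 K)⁰ x'⁻¹ * Ag (cls E') :=
      FractionalIdeal.ext fun φ => by rw [← ((hLab (cls E)) _).2 φ, ← ((hLab (cls E')) _).2 φ, hL]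
    exact hinj E E' x⁻¹ x'⁻¹ (inv_ne_zero hx0) (inv_ne_zero hx'0) hIJ
  · -- (v) the roundings
    intro E _
    have h := hyfloor E
    rw [abs_le]; constructor <;> linarith [h.1, h.2]
  · -- (v) exact affinity
    intro E _ E' _ hEE'
    exact hyaff E E' hEE'
  · -- (vi) run-shaped fibres, few cells
    intro E _
    exact cells_package (hmono (cls E)) (hn₀ (cls E)) (hper (cls E)) (hidx (cls E)) (hLabper (cls E)) s npp (hgap (cls E))
      hLB0 hLBd6 hRd6 (hn₀R (cls E)) hd1 hd27

/-- **The table semantics** `ClaimTableSem` (Buchmann–Williams 1988 §3 / Hallgren 2005 §4: the semantics of the class-group table), from its four parts.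
[cite: BuchmannWilliams1988, §3 (semantics of the class-group table; supporting lemma)] -/
theorem _root_.Literature.Computability.Cryptography.CubicClassSampling.ClaimTableSem_holds : ClaimTableSem :=
  stub_semMain stub_semCoords stub_semDrift stub_semAffine

end Literature.Computability.Cryptography.CubicClassSampling.LinnikStubs

end Part12

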